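import Literature.MathematicalPhysics.QuantumFieldTheory.Balaban1983to89.B8Prop3GaugeFixedKLevel
import Literature.MathematicalPhysics.QuantumFieldTheory.Balaban1983to89.B8Eq137QjEqB
import Literature.MathematicalPhysics.QuantumFieldTheory.Balaban1983to89.B8Ineq172Concrete

/-!
# `Balaban1983to89.B8Eq142KLevelLocal` — [Balaban1985RegularSpaces] the (1.42) clause «Q_j(U₀, ηA) = B on Λ_j, |B| < 2dLα₁»
# (p. 83; = the (1.37) line of Theorem 2 p. 82) AT `k` LEVELS IN TOWER-LOCAL FORM on the concrete `ℤᵈ` carriers — interior constraint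
# bonds — and the hypothesis `H42` of `B8Prop3GaugeFixedKLevel` DISCHARGED: Theorem 4's existence clause at all levels modulo Prop. 5 + b9

statement-level skeleton of published theorems with citation tags; proofs where landed; nothing here is a claim about the
Yang–Mills mass gap

T. Bałaban, *Spaces of regular gauge field configurations on a lattice and gauge fixing conditions*, Commun. Math. Phys. **99**
(1985) 75–102 `[Balaban1985RegularSpaces]` ("B8"; printed page = PDF page + 74), (1.42) p. 83, (1.37) + (1.30)–(1.31) p. 82, (1.35)
p. 82, (1.29) p. 81, (1.19) p. 79, Theorem 4 p. 88; [3] = [Balaban1985Averaging] ((87) p. 31, locality p. 24).  PDF held: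
`paper:balaban1985-cmp99-regular-spaces-gauge-fixing`.  STATUS: published, refereed.

CITATION HEADER (lean-in-tree rule).  Cell `pub-ymgap` (YM Track A, DAG node N05 = [B8], HUMAN RULING D-0062), seat
`pub-ymgap-dag-n04-b` gen 2, STAGE 2 of the owner's cut «hP3-discharge» (n05-a [DAGN05A-G3-CUT-1], dag-lead [REBALANCE-35]).  WHAT IS
REPRODUCED = (1.42)'s clause «|Q_j(U₀, ηA)| < 2dLα₁» FOR THE GAUGE-FIXED FIELDS OF THEOREM 4's INDUCTION at `k` levels — print
derives it from (1.29) + (1.35) through the construction (1.30)–(1.31).  The tree had it (r05, `B8Eq137QjEqB` §§4–8) in [3] Prop. 4's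
GLOBAL regime: `pdev U₀ < α₀L^{−2k}` on ALL of `ℤᵈ` and a GLOBAL exponent bound `sup‖B‖ ≤ b`, `Lᵏb` small — fine for ONE scale, unusable
for a k-level field whose exponent is `O((Lʲη)⁻¹)` on `Ω_j` only.  THIS MODULE localises it to the block towers under the constraint bond
(the standard device of the lineage: `B7Prop1Local.clampCfg` + restriction of the exponent field to the box + the locality theorems
`B7LocalityGeneral.logCovIter_congr`, `B8Ineq172Concrete.wrec_congr_tower`, `B7Prop1Local.avgIter_congr`), and discharges with it the
hypothesis `H42` of `B8Prop3GaugeFixedKLevel.hP3_gaugeFixed_of_b9` / `thm4_exists_all_levels_of_b9` (p417654) for INTERIOR constraint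
bonds.  Kind «kernel-checked proof», theorems only: no `def`, no `… : Prop` fact, no existing module modified.  REUSED BY NAME:
`B8Eq137QjEqB.norm_Qj_lt_interior_regular` / `norm_Qj_lt_interior_zero`, `B8Eq131Derivation.eq87_of_inAx_restr129`,
`B7Prop1Local.{clampCfg, clampCfg_agree, clampCfg_mem, pdev_clampCfg_le, avgIter_congr}`, `B7Prop5Flat.{bondsIn, restr, insCfg_restr_of_mem,
agreeOn_insCfg_restr}`, `B7Prop3Flat.insCfg`, `B7LocalityGeneral.logCovIter_congr`, `B8Ineq172Concrete.wrec_congr_tower`,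
`B8Ineq132.pdevOn_lt_of_forall`, `B8Ineq130.{tlo_apply, thi_apply}`, `B8Eq140Level.sideTouches_of_bondTouches`,
`B7Prop2Explicit.avgClosed_unitaryUnits`, `B8Prop3GaugeFixedKLevel.thm4_exists_all_levels_of_b9`.

## THE PRINTED TEXT

p. 82 [PDF 8] (Theorem 2's list): «Q_j(U₀, ηA) = B on Λ_j, j = 0, 1, …, k, B is given by formula (1.31) with V′ = Ũ′ʲ, |B| < 2dLα₁ by the
assumption (1.35), (1.37)»; p. 83 [PDF 9]: «R(U₀)D^{η*}_{U₀}A = 0, Q_j(U₀, ηA) = B on Λ_j, |B| < 2dLα₁. (1.42)» and «the condition (1.37) is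
basically of an algebraic character and it follows from the construction, as in (1.30), (1.31). The only fact we need to write it this way
is the representation of U₁ and the first condition on A in (1.36).»

## WHAT IS CERTIFIED HERE (kernel; axioms `propext` / `Classical.choice` / `Quot.sound`)

* §1 geometry: `inBox_box_of_tower_fst` / `inBox_box_of_tower_snd` — the block towers `B^{j}(c₋)`, `B^{j}(c₊)` (`B8Ineq130.tlo`/`thi`) under an
  `Lʲ`-bond `c` lie in the box `B^{j}(c₋) ∪ B^{j}(c₊)` (`B7Prop1Local.loK`/`bondHiK`, the locality box of `logCovIter_congr`).
* §2 **`norm_Qj_lt_interior_loc`** — the (1.42) clause AT ONE INTERIOR CONSTRAINT BOND of the `(j+1)`-lattice FROM BOX DATA: `U₀` with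
  plaquettes obeying (1.40) at level `j + 1` INSIDE the box, exponent field `B` bounded by `b` on the box's bonds with `L^{j+1}b` in [3]
  Prop. 4's window, the actual field `U₁` agreeing with `e^{B}` on the box, (87) of [3] at `c₋`, `c₊` for `(U₀, U₁, u)`, (1.35) at `c` for
  `U′U₀ = U₁^{u}U₀` ⇒ `‖Q_{j+1}(U₀, B)(c)‖ < 2dLα₁`.
* §3 **`H42_interior_of_inAx`** — THE HYPOTHESIS `H42` OF `B8Prop3GaugeFixedKLevel.hP3_gaugeFixed_of_b9` AS A THEOREM (its exact shape),
  for constraint-bond families `Λb m j` of INTERIOR bonds of `Λs m j` (`hint`), from the caller's standing hypotheses (1.33) `InAk L k η α₀ Ω U₀`,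
  (1.34)-axial `InAx L m (Λs m) U₀ (U′U₀)` (every `m ≤ k`; from the full structure by `B8Thm4TruncationLocal.inAx_truncate`), (1.35) on the
  constraint bonds in `avgIter` currency, and the windows at `α₂`.  Levels `j ≥ 1` by §2 ((87) from (1.19)/(1.29) by
  `eq87_of_inAx_restr129`), level `0` by `norm_Qj_lt_interior_zero` ((1.14): `u = 1` on `Λ₀`).
* §4 **`thm4_exists_all_levels_of_b9_interior`** — THEOREM 4's EXISTENCE CLAUSE AT ALL LEVELS on the concrete carriers
  (`B8Thm4InductionLocal.thm4_exists_all_levels`) with BOTH `hP3` (p417654) and `H42` (this file) DISCHARGED: it now rests on Proposition 5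
  (sockets `hP5base`/`hP5`, pin-bound letters), the in-edge b9 (`H59` = [4] Thm 3.3 in B8's currency) and the caller's standing
  hypotheses (1.33)/(1.34)/(1.34-axial)/(1.35)/(1.66)₀ ONLY.

## v1.1 (APPEND-ONLY, same seat): §5 the CROSSING bonds of (1.31), §6 the general constraint-bond family

* §5 `inBox_box_of_blockBond` / `inBox_box_of_blockBond_snd` (the level-`j` locality box of a bond of the `L`-block `B(c₋)`, resp. `B(c₊)`,
  lies in the box of `c`); **`norm_Qj_lt_crossing_loc`** (crossing bond `c₋`-block ⊂ Λ_{j}, `c₊ ∈ Λ_{j+1}`: tower-local form of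
  `B8Eq137QjEqB.norm_Qj_lt_crossing_regular`, the `U1`-membership of the averages of `U′U₀ = (e^{B}U₀)^{u}` DERIVED for the clamped data by
  [3] Prop. 2 (`B7Eq123General.level_data`) + the gauge covariance (11) (`B7AvgGaugeCovariance.avgIter_gaugeAct`), the plaquettes of `U₁U₀`
  inside the box being the extra input (1.34)); **`norm_Qj_lt_crossing_mirrored_loc`** (the mirrored orientation, from
  `B8Eq137QjEqB.norm_Qj_lt_crossing_mirrored` with the identification (127) `B7Eq123General.dbavgCovIter_eq_expCfg_logCovIter` for the clamped data).
* §6 **`H42_of_inAx`** — `H42` of `B8Prop3GaugeFixedKLevel` as a theorem for a GENERAL constraint-bond family: every `c ∈ Λb m j` interior, crossing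
  or mirrored-crossing (`hclass`); (1.35) asked on every level-`j` bond whose locality box lies in `Ω_j`; (1.34) in both parts (`h34` plaquettes
  of `U′U₀` on `{Ω_j}`, `hAx` axial); `Ω` antitone.  HONEST SCOPE item (i) below is thereby SUPERSEDED for families satisfying `hclass`; the
  composition with the driver for such families is the separate module `B8Thm4ExistsModB9`.

## HONEST SCOPE — what is NOT claimed

(i) (v1; superseded by §6 for classified families) INTERIOR constraint bonds only (both end-points in `Λs m j`): the CROSSING bonds of (1.31) (`b₋ ∈ Λ_{j−1}`-block, `b₊ ∈ Λ_j`, both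
orientations) need the same localisation of `B8Eq137QjEqB.norm_Qj_lt_crossing_regular` plus the `U1`-membership of the averages of `U′U₀`
([3] Prop. 2 on the box) — the remaining item of the cut; a constraint-bond family of record containing crossing bonds is therefore NOT
yet served by §3/§4.  (ii) The relation between the constraint sites `Λs`, the bonds `Λb` and the domains `Ω` («boxes inside Ω_j», hbox;
interior end-points, hint) is hypothesis, cf. `B8Eq131DomainSeq` / `B8Eq156KLevelLocal.hbox_of_domainSeq` for the admissible families.
(iii) `T_η ↦ ℤᵈ`; `≤`/`<` as typed; `d ≥ 2`, `L ≥ 2`, `𝔸` a C⋆-algebra in §§3–4 (normed algebra with `‖1‖ = 1` in §2).  Nothing here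
discharges the node N05; count-neutral; nothing continuum / mass-gap / Clay.
-/

noncomputable section

open NormedSpace

namespace Literature.MathematicalPhysics.QuantumFieldTheory.Balaban1983to89.B8Eq142KLevelLocal

open Complex (I)
open MatrixLog B7Prop1Explicit B7Prop2Explicit B7Prop1Local B7Eq92Concrete B7Eq99Concrete
open B7Prop3Flat (expCfg c3 insCfg)
open B7Prop4GeneralLevels (logCovIter)
open B7Prop5Flat (bondsIn restr mem_bondsIn insCfg_restr_of_mem agreeOn_insCfg_restr BondIn)
open B7LocalityGeneral (logCovIter_congr)
open B7AvgGaugeCovariance (uLev)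
open B8Ineq130 (tlo thi tlo_apply thi_apply)
open B8Ineq132 (InAk BondTouches pdevOn_lt_of_forall)
open B8Lemma1NonAbelian (mulCfg)
open B8Eq146AExpansion (iEta)
open B8Eq184Proof (cfgExp)
open B8Eq140Level (SideTouches sideTouches_of_bondTouches)
open B8Eq119TwistedAxial (InAx Restr129)
open B8Eq131Derivation (eq87_of_inAx_restr129)
open B8Eq137QjEqB (norm_Qj_lt_interior_regular norm_Qj_lt_interior_zero)
open B8Ineq172Concrete (wrec_congr_tower)
open B8Eq184Proof (gaugeExp)
open B8Ineq132 (covDerivFwd)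
open B7Prop4GeneralLevels (linCovIter)
open B8Eq155JBound (Jcur wsup)
open B8ScaledSupNorm (bondNorm msup)

-- `Site` alone could resolve to the torus sites of `Setup.lean`; re-export the `ℤ^d` sites of `B7Prop1Explicit`.
export B7Prop1Explicit (Site)

variable {d : ℕ}

/-! ## §1 Geometry: the two block towers under an `L^j`-bond sit in the box `B^j(c₋) ∪ B^j(c₊)` -/

section Geometry

/-- The box `B^j(c₋) ∪ B^j(c₊)` is a genuine box: `loK ≤ bondHiK` (private copy of the lineage's lemma). [folklore] -/
private theorem loK_le_bondHiK' {L : ℕ} (hL : 1 ≤ L) (j : ℕ) (z : Site d) (κ : Fin d) :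
    ∀ i, loK L j z i ≤ bondHiK L j z κ i := fun i => by
  have hP : (1 : ℤ) ≤ (L : ℤ) ^ j := one_le_pow₀ (by exact_mod_cast hL)
  simp only [loK, bondHiK]
  split_ifs <;> omega

/-- The block tower `[tlo y j, thi y j] = Bʲ(c₋)` under `c₋ = y` lies in the box `B^j(c₋) ∪ B^j(c₊)`. [cite: Balaban1985Averaging, p.24 (locality of (43))] -/
theorem inBox_box_of_tower_fst (L j : ℕ) (y : Site d) (κ : Fin d) {x : Site d}
    (hx : InBox (tlo L y j) (thi L y j) x) : InBox (loK L j y) (bondHiK L j y κ) x := fun i => by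
  have h1 := (hx i).1
  have h2 := (hx i).2
  rw [tlo_apply] at h1
  rw [thi_apply] at h2
  have hP : (0 : ℤ) ≤ (L : ℤ) ^ j := by positivity
  simp only [loK, bondHiK]
  constructor
  · exact h1
  · split_ifs <;> nlinarith

/-- The block tower `Bʲ(c₊)` under `c₊ = y + e_κ` lies in the box `B^j(c₋) ∪ B^j(c₊)`. [cite: Balaban1985Averaging, p.24 (locality of (43))] -/
theorem inBox_box_of_tower_snd {L : ℕ} (j : ℕ) (y : Site d) (κ : Fin d) {x : Site d}
    (hx : InBox (tlo L (y + e κ) j) (thi L (y + e κ) j) x) : InBox (loK L j y) (bondHiK L j y κ) x := fun i => by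
  have h1 := (hx i).1
  have h2 := (hx i).2
  rw [tlo_apply, add_e_apply] at h1
  rw [thi_apply, add_e_apply] at h2
  have hP : (0 : ℤ) ≤ (L : ℤ) ^ j := by positivity
  simp only [loK, bondHiK]
  constructor
  · split_ifs at h1 <;> nlinarith
  · split_ifs at h2 ⊢ <;> nlinarith

variable {G : Type*}

/-- Agreement on a box restricts to agreement on any sub-box. [folklore] -/
private theorem agreeOn_of_subbox {lo hi LO HI : Site d} {V V' : Site d → Fin d → G}
    (hsub : ∀ x, InBox lo hi x → InBox LO HI x) (h : AgreeOn LO HI V V') : AgreeOn lo hi V V' :=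
  fun x κ hx hxe => h x κ (hsub x hx) (hsub _ hxe)

end Geometry

/-! ## §2 The (1.42) clause at ONE interior constraint bond from BOX DATA (tower-local form of `B8Eq137QjEqB` §5) -/

section Interior

variable {𝔸 : Type*} [NormedRing 𝔸] [NormOneClass 𝔸] [NormedAlgebra ℂ 𝔸] [CompleteSpace 𝔸]

omit [NormOneClass 𝔸] [NormedAlgebra ℂ 𝔸] [CompleteSpace 𝔸] in
/-- The restriction `B|_{box}` (zero outside the bonds of the box) is bounded by a common bound of `B` on the box's bonds
(private plumbing; cf. `B8Eq156KLevelLocal`). [folklore] -/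
private theorem norm_insCfg_restr_le' {lo hi : Site d} {B : Site d → Fin d → 𝔸} {b : ℝ}
    (hB : ∀ x μ, BondIn lo hi x μ → ‖B x μ‖ ≤ b) (hb : 0 ≤ b) :
    ∀ x μ, ‖insCfg (bondsIn lo hi) (restr (bondsIn lo hi) B) x μ‖ ≤ b := fun x μ => by
  by_cases h : (x, μ) ∈ bondsIn lo hi
  · rw [insCfg_restr_of_mem _ _ h]; exact hB x μ (mem_bondsIn.mp h)
  · simp only [insCfg, h, dite_false, norm_zero]; exact hb

/-- **THE (1.42) CLAUSE «|Q_j(U₀, ηA)(c)| < 2dLα₁» AT ONE INTERIOR CONSTRAINT BOND FROM BOX DATA** (tower-local form of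
`B8Eq137QjEqB.norm_Qj_lt_interior_regular`): at a bond `c = ⟨y, y + e_κ⟩` of the `(j+1)`-lattice, if inside the box
`B^{j+1}(c₋) ∪ B^{j+1}(c₊)` the (`G`-valued, `G` averaging-closed) background `U₀` has plaquettes obeying (1.40) at level `j + 1`,
the exponent field `B` (`U₁ = e^{B}` on the box's bonds: `hU₁`) obeys `‖B_b‖ ≤ b` with `L^{j+1}b` in [3] Prop. 4's window, the gauge
transformation `u` satisfies (87) of [3] at `c₋` and `c₊` for `(U₀, U₁)` (as delivered by (1.19)/(1.29), `B8Eq131Derivation.eq87_of_inAx_restr129`),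
and (1.35) holds at `c` for `U′U₀ = (U₁^{u})U₀`, THEN `‖Q_{j+1}(U₀, B)(c)‖ < 2dLα₁`.  PROOF: clamp `U₀` (`B7Prop1Local.clampCfg`) and restrict
`B` to the box, apply the GLOBAL lemma at `k := j + 1`, and transport back by the locality of `Q_{j+1}` (`B7LocalityGeneral.logCovIter_congr`),
of the block averages (85) (`B8Ineq172Concrete.wrec_congr_tower`) and of the `(j+1)`-fold averages (`B7Prop1Local.avgIter_congr`).
[cite: Balaban1985RegularSpaces, (1.42) p.83, (1.37) p.82, (1.35) p.82; Balaban1985Averaging, p.24 (locality), (87) p.31] -/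
theorem norm_Qj_lt_interior_loc (L : ℕ) (hd : 1 ≤ d) (hL : 2 ≤ L) {G : Subgroup 𝔸ˣ} (hG : AvgClosed d L G)
    (j : ℕ) (U₀ : Site d → Fin d → 𝔸ˣ) (y : Site d) (κ : Fin d)
    (hU₀ : ∀ x μ, U₀ x μ ∈ G)
    {α₀ : ℝ} (hα₀ : 0 < α₀) (hα3 : C0 d * α₀ ≤ 1 / 3) (hα4 : 4 * α₀ ≤ c2' d L)
    (h40 : ∀ (x : Site d) (μ ν : Fin d), μ ≠ ν → PlaqIn (loK L (j + 1) y) (bondHiK L (j + 1) y κ) (x, μ, ν) →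
      ‖((hol U₀ x (plaqWord μ ν) : 𝔸ˣ) : 𝔸) - 1‖ < α₀ * (((L : ℝ) ^ (j + 1))⁻¹) ^ 2)
    (B : Site d → Fin d → 𝔸) {b : ℝ} (hb : 0 ≤ b)
    (hB : ∀ x μ, BondIn (loK L (j + 1) y) (bondHiK L (j + 1) y κ) x μ → ‖B x μ‖ ≤ b)
    (hsm : Real.exp (4 * (800 * ((d : ℝ) + 1) ^ 2 * ((d : ℝ) + 4)) * α₀)
      * (1 + 8 * (131072 * ((d : ℝ) + 1) ^ 2) * ((L : ℝ) ^ (j + 1) * b)) ≤ 2)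
    (hc₃ : 2 * ((L : ℝ) ^ (j + 1) * b) ≤ c3 d L)
    (u : Site d → 𝔸ˣ) (U₁ : Site d → Fin d → 𝔸ˣ)
    (hU₁ : AgreeOn (loK L (j + 1) y) (bondHiK L (j + 1) y κ) U₁ (expCfg B))
    (hm : uLev L u (j + 1) y = (wrec L U₀ U₁ (j + 1) y)⁻¹)
    (hp : uLev L u (j + 1) (y + e κ) = (wrec L U₀ U₁ (j + 1) (y + e κ))⁻¹)
    {α₁ : ℝ} (hα : 0 < α₁) (hsmall : (d : ℝ) * L * α₁ ≤ 1 / 8)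
    (h135 : ‖(avgIter L (mgauge U₀ u U₁ * U₀) (j + 1) y κ : 𝔸) - (avgIter L U₀ (j + 1) y κ : 𝔸)‖ ≤ α₁) :
    ‖logCovIter L U₀ B (j + 1) y κ‖ < 2 * d * L * α₁ := by
  have hL1 : 1 ≤ L := le_trans (by norm_num) hL
  set lo := loK L (j + 1) y with hlo
  set hi := bondHiK L (j + 1) y κ with hhi
  have hlohi : ∀ i, lo i ≤ hi i := loK_le_bondHiK' hL1 (j + 1) y κ
  -- the clamped background and its global data
  set U₀' := clampCfg lo hi U₀ with hU₀'_def
  have hU₀1 : ∀ x μ, U₀ x μ ∈ U1 𝔸 := fun x μ => hG.le_U1 (hU₀ x μ)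
  have hU₀'G : ∀ x μ, U₀' x μ ∈ G := clampCfg_mem hU₀
  have hpdOn : pdevOn lo hi U₀ < α₀ * (((L : ℝ) ^ (j + 1))⁻¹) ^ 2 := by
    refine pdevOn_lt_of_forall (by positivity) fun x μ ν hx hx' => ?_
    rcases eq_or_ne μ ν with rfl | hμν
    · rw [hol_plaqWord_self, Units.val_one, sub_self, norm_zero]; positivity
    · exact h40 x μ ν hμν ⟨hx, hx'⟩
  have hpdev : pdev U₀' < α₀ * (((L : ℝ) ^ (j + 1))⁻¹) ^ 2 := (pdev_clampCfg_le hlohi hU₀1).trans_lt hpdOn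
  -- the restricted exponent field and its global bound
  set B' := insCfg (bondsIn lo hi) (restr (bondsIn lo hi) B) with hB'_def
  have hB' : ∀ x μ, ‖B' x μ‖ ≤ b := norm_insCfg_restr_le' hB hb
  -- agreements on the box
  have hagU : AgreeOn lo hi U₀' U₀ := clampCfg_agree U₀
  have hagB : AgreeOn lo hi B B' := agreeOn_insCfg_restr lo hi B
  have hagE : AgreeOn lo hi U₁ (expCfg B') := fun x μ hx hxe => by
    rw [hU₁ x μ hx hxe]
    apply Units.ext
    show exp (B x μ) = exp (B' x μ)
    rw [hagB x μ hx hxe]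
  -- (87) at `c₋`, `c₊` for the clamped pair: the block averages (85) are tower-local
  have hw : ∀ z : Site d, (∀ x, InBox (tlo L z (j + 1)) (thi L z (j + 1)) x → InBox lo hi x) →
      wrec L U₀ U₁ (j + 1) z = wrec L U₀' (expCfg B') (j + 1) z := by
    intro z hsub
    exact wrec_congr_tower hL1 (agreeOn_of_subbox hsub hagU).symm (agreeOn_of_subbox hsub hagE) (j + 1) 0 (by omega) z
      (by rw [B8Ineq130.tlo_zero]) (by rw [B8Ineq130.thi_zero])
  have hm' : uLev L u (j + 1) y = (wrec L U₀' (expCfg B') (j + 1) y)⁻¹ := by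
    rw [hm, hw y fun x hx => inBox_box_of_tower_fst L (j + 1) y κ hx]
  have hp' : uLev L u (j + 1) (y + e κ) = (wrec L U₀' (expCfg B') (j + 1) (y + e κ))⁻¹ := by
    rw [hp, hw (y + e κ) fun x hx => inBox_box_of_tower_snd (j + 1) y κ hx]
  -- (1.35) at `c` for the clamped pair: the `(j+1)`-fold averages are box-local
  have hav₁ : avgIter L (mgauge U₀' u (expCfg B') * U₀') (j + 1) y κ = avgIter L (mgauge U₀ u U₁ * U₀) (j + 1) y κ := by
    refine avgIter_congr L hL1 (j + 1) y κ fun x μ hx hxe => ?_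
    show mgauge U₀' u (expCfg B') x μ * U₀' x μ = mgauge U₀ u U₁ x μ * U₀ x μ
    rw [mgauge_apply, mgauge_apply, hagU x μ hx hxe, (hagE x μ hx hxe).symm]
  have hav₀ : avgIter L U₀' (j + 1) y κ = avgIter L U₀ (j + 1) y κ := avgIter_congr L hL1 (j + 1) y κ hagU
  have h135' : ‖(avgIter L (mgauge U₀' u (expCfg B') * U₀') (j + 1) y κ : 𝔸) - (avgIter L U₀' (j + 1) y κ : 𝔸)‖ ≤ α₁ := by
    rw [hav₁, hav₀]; exact h135
  -- the global lemma for the clamped pair at `k := j + 1`, transported back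
  have key := norm_Qj_lt_interior_regular L hd hL hG (j + 1) U₀' hU₀'G hα₀ hα3 hα4 hpdev B' hb hB' hsm hc₃ u le_rfl y κ
    hm' hp' hα hsmall h135'
  rwa [logCovIter_congr L hL1 (j + 1) y κ hagU hagB.symm] at key

end Interior

/-! ## §3 The (1.42) clause at `k` levels for the gauge-fixed fields of Theorem 4's induction, INTERIOR constraint bonds:
the hypothesis `H42` of `B8Prop3GaugeFixedKLevel.hP3_gaugeFixed_of_b9` DISCHARGED from (1.33), (1.34)-axial, (1.29), (1.35) -/

section KLevel

variable {𝔸 : Type*} [CStarAlgebra 𝔸] [Nontrivial 𝔸]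

omit [Nontrivial 𝔸] in
/-- In dimension `d ≥ 2` every direction has a second one (plaquettes exist). [folklore] -/
private theorem exists_ne_dir' (hd2 : 2 ≤ d) (μ : Fin d) : ∃ κ : Fin d, κ ≠ μ := by
  by_cases h : (μ : ℕ) = 0
  · exact ⟨⟨1, by omega⟩, fun e => by have := congrArg Fin.val e; simp [h] at this⟩
  · exact ⟨⟨0, by omega⟩, fun e => by have := congrArg Fin.val e; simp at this; omega⟩

omit [Nontrivial 𝔸] in
/-- The two exponent-field spellings agree bondwise (`B8Prop3GaugeFixedKLevel.expCfg_iEta_eq_cfgExp`, read for the [3]-lineage's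
`B7Prop3Flat.expCfg`; private plumbing). [folklore] -/
private theorem expCfg_iEta_apply (η : ℝ) (A : Site d → Fin d → 𝔸) (x : Site d) (κ : Fin d) :
    expCfg (iEta η A) x κ = cfgExp η A x κ :=
  congrFun (congrFun (B8Prop3GaugeFixedKLevel.expCfg_iEta_eq_cfgExp η A) x) κ

/-- **THE (1.42) CLAUSE AT `k` LEVELS FOR GAUGE-FIXED FIELDS, INTERIOR CONSTRAINT BONDS — the hypothesis `H42` of
`B8Prop3GaugeFixedKLevel.hP3_gaugeFixed_of_b9` AS A THEOREM** (its exact shape, for constraint-bond families `Λb m j` consisting of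
INTERIOR bonds of `Λs m j`: both end-points in `Λs m j`, `hint`; boxes inside `Ω_j`, `hbox`).  CALLER'S STANDING HYPOTHESES: (1.33)
`U₀ ∈ 𝔄_k({Ω_j}, α₀)` (`h33`); (1.34), axial part, for the truncated structures: `U′U₀ ∈ Ax_m(𝔅_m(Λs m), U₀)` for every `m ≤ k` (`hAx`,
`B8Eq119TwistedAxial.InAx`; from the full structure by `B8Thm4TruncationLocal.inAx_truncate`); (1.35) «|(U′U₀)‾ʲ − Ū₀ʲ| ≤ α₁» on the
constraint bonds (`h135`, `avgIter` currency); the windows of [3] Prop. 4 at `α₂ := 2Lc⋆ + 8α₄` (the SAME `hsmall`, `hc₃` as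
`hP3_gaugeFixed_of_b9`, plus `16α₂ ≤ 1`, `dLα₁ ≤ 1/8`); `d ≥ 2`, `L ≥ 2`, `η > 0`, `U₀` unitary-valued.  For each gauge-fixed datum
`(u, W, A′)` (the premises of `H42`: `u` unitary-valued, `W^{u} = U′`, (1.29) `Restr129 L m (Λs m) U₀ u`, `Lan m W` — unused here —, `A′`
self-adjoint, `W = e^{iηA′}` with `‖A′‖ ≤ α₂(Lʲη)⁻¹` on the sides of the plaquettes touching `Ω_j`, `A′ = 0` elsewhere):
`‖Q_j(U₀, ηA′)(c)‖ < 2dLα₁` for every `c ∈ Λb m j`, `j ≤ m`.  Level `j ≥ 1`: `norm_Qj_lt_interior_loc` ((87) at `c₋`, `c₊` from (1.19)/(1.29) by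
`B8Eq131Derivation.eq87_of_inAx_restr129`); level `0`: `B8Eq137QjEqB.norm_Qj_lt_interior_zero` ((1.14): `u = 1` on `Λ₀`).
[cite: Balaban1985RegularSpaces, (1.42) p.83, (1.37) p.82, (1.35) p.82, (1.29) p.81, (1.19) p.79, Thm 4 p.88] -/
theorem H42_interior_of_inAx (hd2 : 2 ≤ d) {η : ℝ} (hη : 0 < η) {L : ℕ} (hL : 2 ≤ L) (k : ℕ)
    {U₀ U' : Site d → Fin d → 𝔸ˣ} (hU₀ : ∀ x κ, U₀ x κ ∈ unitaryUnits 𝔸)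
    {α₀ α₁ α₂ : ℝ} (hα₀ : 0 < α₀) (hα₁ : 0 < α₁) (hα₂ : 0 ≤ α₂)
    (hα3 : C0 d * α₀ ≤ 1 / 3) (hα4 : 4 * α₀ ≤ c2' d L) (h16 : 16 * α₂ ≤ 1)
    (hsmall : Real.exp (4 * (800 * ((d : ℝ) + 1) ^ 2 * ((d : ℝ) + 4)) * α₀) * (1 + 8 * (131072 * ((d : ℝ) + 1) ^ 2) * α₂) ≤ 2)
    (hc₃ : 2 * α₂ ≤ c3 d L) (hsmall₁ : (d : ℝ) * L * α₁ ≤ 1 / 8)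
    (Ω : ℕ → Set (Site d)) (Λs : ℕ → ℕ → Set (Site d)) (Λb : ℕ → ℕ → Set (Site d × Fin d))
    (hbox : ∀ m, m ≤ k → ∀ j, j ≤ m → ∀ c ∈ Λb m j, ∀ x, InBox (loK L j c.1) (bondHiK L j c.1 c.2) x → x ∈ Ω j)
    (hint : ∀ m, m ≤ k → ∀ j, j ≤ m → ∀ c ∈ Λb m j, c.1 ∈ Λs m j ∧ c.1 + e c.2 ∈ Λs m j)
    (h33 : InAk L k η α₀ Ω U₀) (hAx : ∀ m, m ≤ k → InAx L m (Λs m) U₀ (mulCfg U' U₀))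
    (h135 : ∀ m, m ≤ k → ∀ j, j ≤ m → ∀ c ∈ Λb m j,
      ‖(avgIter L (mulCfg U' U₀) j c.1 c.2 : 𝔸) - (avgIter L U₀ j c.1 c.2 : 𝔸)‖ ≤ α₁)
    (Lan : ℕ → (Site d → Fin d → 𝔸ˣ) → Prop) :
    ∀ m, 1 ≤ m → m ≤ k → ∀ (u : Site d → 𝔸ˣ) (W : Site d → Fin d → 𝔸ˣ) (A' : Site d → Fin d → 𝔸),
      (∀ x, u x ∈ unitaryUnits 𝔸) → mgauge U₀ u W = U' → Restr129 L m (Λs m) U₀ u → Lan m W →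
      (∀ y τ, IsSelfAdjoint (A' y τ)) →
      (∀ j, j ≤ m → ∀ y τ, SideTouches (Ω j) y τ →
        W y τ = cfgExp η A' y τ ∧ ‖A' y τ‖ ≤ α₂ * ((L : ℝ) ^ j * η)⁻¹) →
      (∀ y τ, (∀ j, j ≤ m → ¬ SideTouches (Ω j) y τ) → A' y τ = 0) →
      ∀ j, j ≤ m → ∀ c ∈ Λb m j, ‖logCovIter L U₀ (iEta η A') j c.1 c.2‖ < 2 * d * L * α₁ := by
  intro m _ hmk u W A' _ hW h129 _ _ hWA _ j hj c hc
  have hL1 : 1 ≤ L := le_trans (by norm_num) hL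
  have hd1 : 1 ≤ d := le_trans (by norm_num) hd2
  have hLr : (1 : ℝ) ≤ L := by exact_mod_cast hL1
  have hG : AvgClosed d L (unitaryUnits 𝔸) := avgClosed_unitaryUnits d L
  obtain ⟨hy, hyκ⟩ := hint m hmk j hj c hc
  -- the field `WU₀` is `U′U₀`
  have hWU : mgauge U₀ u W * U₀ = mulCfg U' U₀ := by rw [hW]; rfl
  -- (87) at the constraint sites of `Λs m`, all levels, from (1.19)/(1.29)
  have h87 := eq87_of_inAx_restr129 L hL1 m (Λs m) U₀ W u (by rw [hWU]; exact hAx m hmk) h129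
  -- on the bonds of the box: `W = e^{iηA′}` and `‖iηA′‖ ≤ α₂L^{−j}`
  have hboxbond : ∀ x μ, BondIn (loK L j c.1) (bondHiK L j c.1 c.2) x μ →
      W x μ = cfgExp η A' x μ ∧ ‖iEta η A' x μ‖ ≤ α₂ * ((L : ℝ) ^ j)⁻¹ := by
    intro x μ hb
    obtain ⟨ν, hν⟩ := exists_ne_dir' hd2 μ
    have hs : SideTouches (Ω j) x μ := sideTouches_of_bondTouches hν (Or.inl (hbox m hmk j hj c hc x hb.1))
    obtain ⟨hWx, hAx'⟩ := hWA j hj x μ hs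
    refine ⟨hWx, ?_⟩
    have hLj : (0 : ℝ) < (L : ℝ) ^ j := by positivity
    show ‖((I : ℂ) * η) • A' x μ‖ ≤ α₂ * ((L : ℝ) ^ j)⁻¹
    rw [norm_smul, norm_mul, Complex.norm_I, one_mul, Complex.norm_real, Real.norm_eq_abs, abs_of_pos hη]
    calc η * ‖A' x μ‖ ≤ η * (α₂ * ((L : ℝ) ^ j * η)⁻¹) := mul_le_mul_of_nonneg_left hAx' hη.le
      _ = α₂ * ((L : ℝ) ^ j)⁻¹ := by field_simp
  rcases j with _ | j
  · -- LEVEL 0: (1.14) `u = 1` on `Λ₀`, `Q₀(U₀, ηA′) = iηA′`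
    have hb0 : BondIn (loK L 0 c.1) (bondHiK L 0 c.1 c.2) c.1 c.2 := by
      refine ⟨fun i => ?_, fun i => ?_⟩
      · simp only [loK, bondHiK, pow_zero, one_mul]; split_ifs <;> omega
      · simp only [loK, bondHiK, pow_zero, one_mul, add_e_apply]; split_ifs <;> omega
    obtain ⟨hWc, hAc⟩ := hboxbond c.1 c.2 hb0
    have hlog2 : ‖iEta η A' c.1 c.2‖ < Real.log 2 := by
      have := Real.log_two_gt_d9
      rw [pow_zero, inv_one, mul_one] at hAc
      linarith
    have hm0 : uLev L u 0 c.1 = (wrec L U₀ (expCfg (iEta η A')) 0 c.1)⁻¹ := by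
      rw [h87 0 (Nat.zero_le _) c.1 hy, wrec_zero, wrec_zero]
    have hp0 : uLev L u 0 (c.1 + e c.2) = (wrec L U₀ (expCfg (iEta η A')) 0 (c.1 + e c.2))⁻¹ := by
      rw [h87 0 (Nat.zero_le _) (c.1 + e c.2) hyκ, wrec_zero, wrec_zero]
    have h₀ : avgIter L U₀ 0 c.1 c.2 ∈ U1 𝔸 := by rw [avgIter_zero]; exact unitaryUnits_le_U1 (hU₀ _ _)
    have h135' : ‖(avgIter L (mgauge U₀ u (expCfg (iEta η A')) * U₀) 0 c.1 c.2 : 𝔸) - (avgIter L U₀ 0 c.1 c.2 : 𝔸)‖ ≤ α₁ := by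
      have hpt : (mgauge U₀ u (expCfg (iEta η A')) * U₀) c.1 c.2 = mulCfg U' U₀ c.1 c.2 := by
        rw [← hWU]
        show mgauge U₀ u (expCfg (iEta η A')) c.1 c.2 * U₀ c.1 c.2 = mgauge U₀ u W c.1 c.2 * U₀ c.1 c.2
        rw [mgauge_apply, mgauge_apply, expCfg_iEta_apply, ← hWc]
      have h := h135 m hmk 0 hj c hc
      rw [avgIter_zero, avgIter_zero] at h ⊢
      rw [hpt]
      exact h
    exact norm_Qj_lt_interior_zero L hd1 hL1 U₀ (iEta η A') u c.1 c.2 hlog2 hm0 hp0 h₀ hα₁ hsmall₁ h135'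
  · -- LEVEL `j + 1 ≥ 1`: the box lemma
    set b : ℝ := α₂ * ((L : ℝ) ^ (j + 1))⁻¹ with hb_def
    have hb0 : 0 ≤ b := by positivity
    have hLb : (L : ℝ) ^ (j + 1) * b = α₂ := by
      rw [hb_def]; field_simp
    have hsm' : Real.exp (4 * (800 * ((d : ℝ) + 1) ^ 2 * ((d : ℝ) + 4)) * α₀)
        * (1 + 8 * (131072 * ((d : ℝ) + 1) ^ 2) * ((L : ℝ) ^ (j + 1) * b)) ≤ 2 := by rw [hLb]; exact hsmall
    have hc₃' : 2 * ((L : ℝ) ^ (j + 1) * b) ≤ c3 d L := by rw [hLb]; exact hc₃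
    have hag : AgreeOn (loK L (j + 1) c.1) (bondHiK L (j + 1) c.1 c.2) W (expCfg (iEta η A')) := fun x μ hx hxe => by
      rw [(hboxbond x μ ⟨hx, hxe⟩).1, expCfg_iEta_apply]
    have h40 : ∀ (x : Site d) (μ ν : Fin d), μ ≠ ν → PlaqIn (loK L (j + 1) c.1) (bondHiK L (j + 1) c.1 c.2) (x, μ, ν) →
        ‖((hol U₀ x (plaqWord μ ν) : 𝔸ˣ) : 𝔸) - 1‖ < α₀ * (((L : ℝ) ^ (j + 1))⁻¹) ^ 2 :=
      fun x μ ν hμν hp => (h33 (j + 1) (hj.trans hmk)).1 x μ ν hμν (Or.inl (hbox m hmk (j + 1) hj c hc x hp.1))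
    have h135' : ‖(avgIter L (mgauge U₀ u W * U₀) (j + 1) c.1 c.2 : 𝔸) - (avgIter L U₀ (j + 1) c.1 c.2 : 𝔸)‖ ≤ α₁ := by
      rw [hWU]; exact h135 m hmk (j + 1) hj c hc
    exact norm_Qj_lt_interior_loc L hd1 hL hG j U₀ c.1 c.2 hU₀ hα₀ hα3 hα4 h40 (iEta η A') hb0
      (fun x μ hbd => (hboxbond x μ hbd).2) hsm' hc₃' u W hag (h87 (j + 1) hj c.1 hy) (h87 (j + 1) hj (c.1 + e c.2) hyκ)
      hα₁ hsmall₁ h135'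

/-! ## §4 The composition: Theorem 4's existence clause at all levels with BOTH sockets `hP3` and `H42` discharged
(interior constraint bonds) — modulo Proposition 5 and the in-edge b9 only -/

/-- **THEOREM 4, EXISTENCE CLAUSE AT ALL LEVELS ON THE CONCRETE `ℤᵈ` CARRIERS, MODULO PROPOSITION 5 (sockets `hP5base`/`hP5`) AND THE
IN-EDGE b9 (`H59`) ONLY** — `B8Prop3GaugeFixedKLevel.thm4_exists_all_levels_of_b9` with its (1.42) hypothesis `H42` DISCHARGED by
`H42_interior_of_inAx`, for constraint-bond families `Λb m j` of INTERIOR bonds of `Λs m j` (`hint`) with boxes in `Ω_j` (`hbox`).  Caller's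
standing hypotheses as there plus (1.34)-axial `hAx` and (1.35) `h135`. [cite: Balaban1985RegularSpaces, Thm 4 p.88, Prop. 3 p.87, Prop. 5 p.94, (1.42) p.83, pp.94–95] -/
theorem thm4_exists_all_levels_of_b9_interior (hd2 : 2 ≤ d) {η : ℝ} (hη : 0 < η) {L : ℕ} (hL : 2 ≤ L) (k : ℕ)
    {U₀ U' : Site d → Fin d → 𝔸ˣ} (hU₀ : ∀ x κ, U₀ x κ ∈ unitaryUnits 𝔸) (hU' : ∀ x κ, U' x κ ∈ unitaryUnits 𝔸)
    {α₀ α₁ α₄ B₀ cstar a : ℝ} (hα₀ : 0 < α₀) (hα₁ : 0 < α₁) (hα₄ : 0 ≤ α₄) (hB₀ : 0 ≤ B₀)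
    (hc : cstar = 5 * d * L * B₀ * (α₀ + α₁))
    (hs₁ : α₄ ≤ 1 / 84) (hs₂ : L * cstar ≤ 1 / 12) (ha : a ≤ 1 / 4) (ha2 : 2 * a ≤ cstar)
    (hα3 : C0 d * α₀ ≤ 1 / 3) (hα4 : 4 * α₀ ≤ c2' d L)
    (h16 : 16 * (2 * (L * cstar) + 8 * α₄) ≤ 1) (hd5 : 5 * (2 * (L * cstar) + 8 * α₄) * ((d : ℝ) - 1) ≤ 4)
    (hsmall : Real.exp (4 * (800 * ((d : ℝ) + 1) ^ 2 * ((d : ℝ) + 4)) * α₀)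
      * (1 + 8 * (131072 * ((d : ℝ) + 1) ^ 2) * (2 * (L * cstar) + 8 * α₄)) ≤ 2)
    (hc₃ : 2 * (2 * (L * cstar) + 8 * α₄) ≤ c3 d L) (hside : 36 * d * B₀ * (2 * (L * cstar) + 8 * α₄) ≤ 1 / 2)
    (h50 : 50 * d * (2 * (L * cstar) + 8 * α₄) ≤ 1) (hsmall₁ : (d : ℝ) * L * α₁ ≤ 1 / 8)
    {C₂ : ℝ} (hC₂ : 8 * (131072 * ((d : ℝ) + 1) ^ 2) * Real.exp (4 * (800 * ((d : ℝ) + 1) ^ 2 * ((d : ℝ) + 4)) * α₀) ≤ C₂)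
    (h61 : 2 * (2 * (L * cstar) + 8 * α₄) ^ 2 + 20 * d * α₀ * (2 * (L * cstar) + 8 * α₄)
      + 2 * C₂ * (2 * (L * cstar) + 8 * α₄) ^ 2 ≤ α₀ + α₁)
    (Ω : ℕ → Set (Site d)) (hΩ : ∀ j, Ω (j + 1) ⊆ Ω j) (Λs : ℕ → ℕ → Set (Site d)) (Λb : ℕ → ℕ → Set (Site d × Fin d))
    (hbox : ∀ m, m ≤ k → ∀ j, j ≤ m → ∀ c ∈ Λb m j, ∀ x, InBox (loK L j c.1) (bondHiK L j c.1 c.2) x → x ∈ Ω j)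
    (hint : ∀ m, m ≤ k → ∀ j, j ≤ m → ∀ c ∈ Λb m j, c.1 ∈ Λs m j ∧ c.1 + e c.2 ∈ Λs m j)
    (h33 : InAk L k η α₀ Ω U₀) (h34 : InAk L k η α₀ Ω (mulCfg U' U₀))
    (hAx : ∀ m, m ≤ k → InAx L m (Λs m) U₀ (mulCfg U' U₀))
    (h135 : ∀ m, m ≤ k → ∀ j, j ≤ m → ∀ c ∈ Λb m j,
      ‖(avgIter L (mulCfg U' U₀) j c.1 c.2 : 𝔸) - (avgIter L U₀ j c.1 c.2 : 𝔸)‖ ≤ α₁)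
    (h66 : ∀ b ∈ {b : Site d × Fin d | SideTouches (Ω 0) b.1 b.2}, ‖((U' b.1 b.2 : 𝔸ˣ) : 𝔸) - 1‖ ≤ a)
    (Lan : ℕ → (Site d → Fin d → 𝔸ˣ) → Prop)
    (hP5base : ∃ (v : Site d → 𝔸ˣ) (lam : Site d → 𝔸), (∀ x, v x ∈ unitaryUnits 𝔸) ∧
        (∀ j, j ≤ 1 → ∀ b ∈ {b : Site d × Fin d | SideTouches (Ω j) b.1 b.2}, (v b.1 : 𝔸) = ((gaugeExp lam b.1 : 𝔸ˣ) : 𝔸) ∧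
          (v (b.1 + e b.2) : 𝔸) = ((gaugeExp lam (b.1 + e b.2) : 𝔸ˣ) : 𝔸)) ∧
        (∀ j, j ≤ 1 → ∀ b ∈ {b : Site d × Fin d | SideTouches (Ω j) b.1 b.2},
          ‖lam b.1‖ ≤ α₄ ∧ ((L : ℝ) ^ j * η) * ‖covDerivFwd η U₀ b.2 lam b.1‖ ≤ α₄) ∧
        Lan 1 (mgauge U₀ v⁻¹ U') ∧ Restr129 L 1 (Λs 1) U₀ ((1 : Site d → 𝔸ˣ) * v))
    (hP5 : ∀ m, 1 ≤ m → m < k → ∀ (u₁ : Site d → 𝔸ˣ) (U₁ : Site d → Fin d → 𝔸ˣ) (A : Site d → Fin d → 𝔸),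
      (∀ x, u₁ x ∈ unitaryUnits 𝔸) → mgauge U₀ u₁ U₁ = U' → Restr129 L m (Λs m) U₀ u₁ → Lan m U₁ →
      (∀ j, j ≤ m → ∀ b ∈ {b : Site d × Fin d | SideTouches (Ω j) b.1 b.2},
        U₁ b.1 b.2 = cfgExp η A b.1 b.2 ∧ IsSelfAdjoint (A b.1 b.2) ∧ ‖A b.1 b.2‖ ≤ cstar * ((L : ℝ) ^ j * η)⁻¹) →
      ∃ (v : Site d → 𝔸ˣ) (lam : Site d → 𝔸), (∀ x, v x ∈ unitaryUnits 𝔸) ∧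
        (∀ j, j ≤ m + 1 → ∀ b ∈ {b : Site d × Fin d | SideTouches (Ω j) b.1 b.2}, (v b.1 : 𝔸) = ((gaugeExp lam b.1 : 𝔸ˣ) : 𝔸) ∧
          (v (b.1 + e b.2) : 𝔸) = ((gaugeExp lam (b.1 + e b.2) : 𝔸ˣ) : 𝔸)) ∧
        (∀ j, j ≤ m + 1 → ∀ b ∈ {b : Site d × Fin d | SideTouches (Ω j) b.1 b.2},
          ‖lam b.1‖ ≤ α₄ ∧ ((L : ℝ) ^ j * η) * ‖covDerivFwd η U₀ b.2 lam b.1‖ ≤ α₄) ∧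
        Lan (m + 1) (mgauge U₀ v⁻¹ U₁) ∧ Restr129 L (m + 1) (Λs (m + 1)) U₀ (u₁ * v))
    (H59 : ∀ m, 1 ≤ m → m ≤ k → ∀ (u : Site d → 𝔸ˣ) (W : Site d → Fin d → 𝔸ˣ) (A' : Site d → Fin d → 𝔸),
      (∀ x, u x ∈ unitaryUnits 𝔸) → mgauge U₀ u W = U' → Restr129 L m (Λs m) U₀ u → Lan m W →
      (∀ y τ, IsSelfAdjoint (A' y τ)) →
      (∀ j, j ≤ m → ∀ y τ, SideTouches (Ω j) y τ →
        W y τ = cfgExp η A' y τ ∧ ‖A' y τ‖ ≤ (2 * (L * cstar) + 8 * α₄) * ((L : ℝ) ^ j * η)⁻¹) →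
      (∀ y τ, (∀ j, j ≤ m → ¬ SideTouches (Ω j) y τ) → A' y τ = 0) →
      msup L m η (-(1 : ℝ)) (fun j (b : Site d × Fin d) => SideTouches (Ω j) b.1 b.2) (fun b => A' b.1 b.2)
          ≤ B₀ * (bondNorm L m η (-(3 : ℝ)) Ω (fun x μ => Jcur η U₀ A' μ x)
            + wsup 1 (fun p : {p : ℕ × (Site d × Fin d) // p.1 ≤ m ∧ p.2 ∈ Λb m p.1} =>
                linCovIter L U₀ (iEta η A') p.1.1 p.1.2.1 p.1.2.2)) ∧
        msup L m η (-(2 : ℝ)) (fun j (t : Fin d × Fin d × Site d) => SideTouches (Ω j) t.2.2 t.2.1)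
            (fun t => covDerivFwd η U₀ t.1 (fun z => A' z t.2.1) t.2.2)
          ≤ B₀ * (bondNorm L m η (-(3 : ℝ)) Ω (fun x μ => Jcur η U₀ A' μ x)
            + wsup 1 (fun p : {p : ℕ × (Site d × Fin d) // p.1 ≤ m ∧ p.2 ∈ Λb m p.1} =>
                linCovIter L U₀ (iEta η A') p.1.1 p.1.2.1 p.1.2.2))) :
    ∀ m, m ≤ k → ∃ u : Site d → 𝔸ˣ, (∀ x, u x ∈ unitaryUnits 𝔸) ∧ Restr129 L m (Λs m) U₀ u ∧
      ∃ W : Site d → Fin d → 𝔸ˣ, mgauge U₀ u W = U' ∧ (1 ≤ m → Lan m W) ∧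
        ∃ A : Site d → Fin d → 𝔸, ∀ j, j ≤ m → ∀ b ∈ {b : Site d × Fin d | SideTouches (Ω j) b.1 b.2},
          W b.1 b.2 = cfgExp η A b.1 b.2 ∧ IsSelfAdjoint (A b.1 b.2) ∧ ‖A b.1 b.2‖ ≤ cstar * ((L : ℝ) ^ j * η)⁻¹ := by
  have hcstar : 0 ≤ cstar := by rw [hc]; positivity
  have hα₂ : 0 ≤ 2 * (L * cstar) + 8 * α₄ := by positivity
  exact B8Prop3GaugeFixedKLevel.thm4_exists_all_levels_of_b9 hd2 hη hL k hU₀ hU' hα₀ hα₁.le hα₄ hB₀ hc hs₁ hs₂ ha ha2 hα3 hα4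
    h16 hd5 hsmall hc₃ hside h50 hC₂ h61 Ω hΩ Λs Λb hbox h33 h34 h66 Lan hP5base hP5
    (H42_interior_of_inAx hd2 hη hL k hU₀ hα₀ hα₁ hα₂ hα3 hα4 h16 hsmall hc₃ hsmall₁ Ω Λs Λb hbox hint h33 hAx h135 Lan)
    H59

end KLevel

#print axioms H42_interior_of_inAx
#print axioms thm4_exists_all_levels_of_b9_interior

/-! ## §5 (v1.1) The (1.42) clause at ONE CROSSING constraint bond from BOX DATA (tower-local form of
`B8Eq137QjEqB.norm_Qj_lt_crossing_regular`) -/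

section Crossing

open B8Ineq132 (Under)
open B8Thm2LogB (blockTop)

variable {G : Type*} [Group G] {lo hi : Site d}

/-- `π^*(VW) = π^*V · π^*W` (the clamp `B7Prop1Local.clampCfg` acts bondwise; private copy of the lineage's lemma). [folklore] -/
private theorem clampCfg_mul' (V W : Site d → Fin d → G) : clampCfg lo hi (V * W) = clampCfg lo hi V * clampCfg lo hi W := by
  funext x κ
  simp only [clampCfg, Pi.mul_apply]
  split_ifs <;> simp

/-- A site of the `L`-block `B(y)` (`Ly ≤ x ≤ Ly + (L − 1)𝟙`) is UNDER `y` one level up (private plumbing). [folklore] -/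
private theorem under_one_of_block' {L : ℕ} {y x : Site d} (h1 : (L : ℤ) • y ≤ x) (h2 : x ≤ (L : ℤ) • y + blockTop L) :
    Under L 1 y x := fun i => by
  have a := h1 i
  have b := h2 i
  simp only [Pi.smul_apply, smul_eq_mul, Pi.add_apply, blockTop] at a b
  constructor
  · simpa [pow_one] using a
  · rw [pow_one]; linarith

variable {𝔸 : Type*} [NormedRing 𝔸] [NormOneClass 𝔸] [NormedAlgebra ℂ 𝔸] [CompleteSpace 𝔸]

omit [NormOneClass 𝔸] in
/-- `π^*(e^{B}) = e^{B^π}` for the clamped exponent `B^π(x, κ) = B(πx, κ)` on the clamp's bonds, `0` elsewhere (private copy of the lineage's lemma).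
[folklore] -/
private theorem clampCfg_expCfg' (lo hi : Site d) (B : Site d → Fin d → 𝔸) :
    clampCfg lo hi (expCfg B) = expCfg (fun x κ => if lo κ ≤ x κ ∧ x κ < hi κ then B (clamp lo hi x) κ else 0) := by
  funext x κ
  simp only [clampCfg, expCfg]
  split_ifs
  · rfl
  · exact (B7Prop8Flat.expUnit_zero (𝔸 := 𝔸)).symm

omit [NormOneClass 𝔸] [NormedAlgebra ℂ 𝔸] [CompleteSpace 𝔸] in
/-- The clamped exponent inherits the box bound on the box's bonds (private copy of the lineage's lemma). [folklore] -/
private theorem norm_clampB_le' {lo hi : Site d} (hlohi : ∀ i, lo i ≤ hi i) {B : Site d → Fin d → 𝔸} {b : ℝ} (hb : 0 ≤ b)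
    (hB : ∀ x μ, BondIn lo hi x μ → ‖B x μ‖ ≤ b) (x : Site d) (κ : Fin d) :
    ‖(fun x κ => if lo κ ≤ x κ ∧ x κ < hi κ then B (clamp lo hi x) κ else 0) x κ‖ ≤ b := by
  by_cases hP : lo κ ≤ x κ ∧ x κ < hi κ
  · simp only [hP, and_self, if_true]
    have hx := clamp_inBox hlohi x
    have hxe : InBox lo hi (clamp lo hi x + e κ) := by rw [← clamp_add_e_of hP]; exact clamp_inBox hlohi _
    exact hB _ κ ⟨hx, hxe⟩
  · simp only [hP, if_false, norm_zero]
    exact hb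

omit [NormedRing 𝔸] [NormOneClass 𝔸] [NormedAlgebra ℂ 𝔸] [CompleteSpace 𝔸] in
/-- The level-`j` locality box of a bond `⟨z, z + e_μ⟩` of the `L`-block `B(y)` lies in the level-`(j+1)` box `B^{j+1}(c₋) ∪ B^{j+1}(c₊)` of
`c = ⟨y, y + e_κ⟩` (block geometry). [cite: Balaban1985Averaging, p.24 (locality of (43))] -/
theorem inBox_box_of_blockBond {L : ℕ} (hL : 1 ≤ L) (j : ℕ) (y : Site d) (κ : Fin d) {z : Site d} {μ : Fin d}
    (h1 : (L : ℤ) • y ≤ z) (h2 : z + e μ ≤ (L : ℤ) • y + blockTop L) {w : Site d}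
    (hw : InBox (loK L j z) (bondHiK L j z μ) w) : InBox (loK L (j + 1) y) (bondHiK L (j + 1) y κ) w := fun i => by
  have a : (L : ℤ) * y i ≤ z i := by have := h1 i; simpa [Pi.smul_apply, smul_eq_mul] using this
  have hz : z i + (if i = μ then 1 else 0) ≤ (L : ℤ) * y i + ((L : ℤ) - 1) := by
    have b := h2 i
    have hb' : (z + e μ) i = z i + (if i = μ then 1 else 0) := add_e_apply z μ i
    rw [hb'] at b
    simpa [Pi.add_apply, Pi.smul_apply, smul_eq_mul, blockTop] using b
  have hw1 := (hw i).1
  have hw2 := (hw i).2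
  simp only [loK, bondHiK] at hw1 hw2 ⊢
  have hP : (0 : ℤ) ≤ (L : ℤ) ^ j := by positivity
  have hP1 : (0 : ℤ) ≤ (L : ℤ) ^ (j + 1) := by positivity
  have e1 : (L : ℤ) ^ (j + 1) = (L : ℤ) ^ j * L := pow_succ _ _
  constructor
  · have : (L : ℤ) ^ j * ((L : ℤ) * y i) ≤ (L : ℤ) ^ j * z i := mul_le_mul_of_nonneg_left a hP
    rw [e1]; linarith
  · have ht : (if i = μ then (L : ℤ) ^ j else 0) = (L : ℤ) ^ j * (if i = μ then 1 else 0) := by split_ifs <;> simp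
    have hs : (0 : ℤ) ≤ (if i = κ then (L : ℤ) ^ (j + 1) else 0) := by split_ifs <;> [exact hP1; exact le_rfl]
    have hmul := mul_le_mul_of_nonneg_left hz hP
    calc w i ≤ (L : ℤ) ^ j * z i + ((L : ℤ) ^ j - 1) + (if i = μ then (L : ℤ) ^ j else 0) := hw2
      _ = (L : ℤ) ^ j * (z i + (if i = μ then 1 else 0)) + (L : ℤ) ^ j - 1 := by rw [ht]; ring
      _ ≤ (L : ℤ) ^ j * ((L : ℤ) * y i + ((L : ℤ) - 1)) + (L : ℤ) ^ j - 1 := by linarith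
      _ = (L : ℤ) ^ (j + 1) * y i + ((L : ℤ) ^ (j + 1) - 1) := by rw [e1]; ring
      _ ≤ (L : ℤ) ^ (j + 1) * y i + ((L : ℤ) ^ (j + 1) - 1) + (if i = κ then (L : ℤ) ^ (j + 1) else 0) := by linarith

/-- The same for a bond of the `L`-block `B(c₊)` under the UPPER end-point `c₊ = y + e_κ` (block geometry, mirrored orientation).
[cite: Balaban1985Averaging, p.24 (locality of (43))] -/
theorem inBox_box_of_blockBond_snd {L : ℕ} (hL : 1 ≤ L) (j : ℕ) (y : Site d) (κ : Fin d) {z : Site d} {μ : Fin d}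
    (h1 : (L : ℤ) • (y + e κ) ≤ z) (h2 : z + e μ ≤ (L : ℤ) • (y + e κ) + blockTop L) {w : Site d}
    (hw : InBox (loK L j z) (bondHiK L j z μ) w) : InBox (loK L (j + 1) y) (bondHiK L (j + 1) y κ) w := fun i => by
  have hyκ : (y + e κ) i = y i + (if i = κ then 1 else 0) := add_e_apply y κ i
  have a : (L : ℤ) * (y i + (if i = κ then 1 else 0)) ≤ z i := by
    have := h1 i; rw [Pi.smul_apply, hyκ, smul_eq_mul] at this; exact this
  have hz : z i + (if i = μ then 1 else 0) ≤ (L : ℤ) * (y i + (if i = κ then 1 else 0)) + ((L : ℤ) - 1) := by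
    have b := h2 i
    have hb' : (z + e μ) i = z i + (if i = μ then 1 else 0) := add_e_apply z μ i
    rw [hb', Pi.add_apply, Pi.smul_apply, hyκ, smul_eq_mul] at b
    simpa [blockTop] using b
  have hw1 := (hw i).1
  have hw2 := (hw i).2
  simp only [loK, bondHiK] at hw1 hw2 ⊢
  have hP : (0 : ℤ) ≤ (L : ℤ) ^ j := by positivity
  have hP1 : (0 : ℤ) ≤ (L : ℤ) ^ (j + 1) := by positivity
  have hL0 : (0 : ℤ) ≤ (L : ℤ) := by positivity
  have e1 : (L : ℤ) ^ (j + 1) = (L : ℤ) ^ j * L := pow_succ _ _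
  have hk0 : (0 : ℤ) ≤ (if i = κ then 1 else 0) := by split_ifs <;> norm_num
  constructor
  · have h3 : (L : ℤ) ^ j * ((L : ℤ) * (y i + (if i = κ then 1 else 0))) ≤ (L : ℤ) ^ j * z i := mul_le_mul_of_nonneg_left a hP
    have h4 : (L : ℤ) ^ j * ((L : ℤ) * y i) ≤ (L : ℤ) ^ j * ((L : ℤ) * (y i + (if i = κ then 1 else 0))) := by
      apply mul_le_mul_of_nonneg_left _ hP
      nlinarith
    rw [e1]; linarith
  · have ht : (if i = μ then (L : ℤ) ^ j else 0) = (L : ℤ) ^ j * (if i = μ then 1 else 0) := by split_ifs <;> simp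
    have hs : (if i = κ then (L : ℤ) ^ (j + 1) else 0) = (L : ℤ) ^ (j + 1) * (if i = κ then 1 else 0) := by split_ifs <;> simp
    have hmul := mul_le_mul_of_nonneg_left hz hP
    calc w i ≤ (L : ℤ) ^ j * z i + ((L : ℤ) ^ j - 1) + (if i = μ then (L : ℤ) ^ j else 0) := hw2
      _ = (L : ℤ) ^ j * (z i + (if i = μ then 1 else 0)) + (L : ℤ) ^ j - 1 := by rw [ht]; ring
      _ ≤ (L : ℤ) ^ j * ((L : ℤ) * (y i + (if i = κ then 1 else 0)) + ((L : ℤ) - 1)) + (L : ℤ) ^ j - 1 := by linarith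
      _ = (L : ℤ) ^ (j + 1) * y i + ((L : ℤ) ^ (j + 1) - 1) + (if i = κ then (L : ℤ) ^ (j + 1) else 0) := by rw [hs, e1]; ring

/-- **THE (1.42) CLAUSE AT ONE CROSSING CONSTRAINT BOND FROM BOX DATA** (tower-local form of `B8Eq137QjEqB.norm_Qj_lt_crossing_regular`): at a
bond `c = ⟨y, y + e_κ⟩` of the `(j+1)`-lattice whose LOWER end-point's `L`-block `B(c₋)` consists of constraint sites of level `j` (print:
«All sites of the contours Γ_{b₋,x} belong to Λ_{j−1}», p. 82: (87) of [3] at level `j` on the block, `h87`) and whose upper end-point is a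
constraint site of level `j + 1` ((87) at `c₊`, `hp`), if inside the box `B^{j+1}(c₋) ∪ B^{j+1}(c₊)` the `G`-valued background `U₀` AND the
field `U₁U₀` (`U₁ = e^{B}` on the box, `e^{B}` `G`-valued) have plaquettes obeying (1.40) at level `j + 1` (`h40`, `h40'` — (1.33)/(1.34)),
`‖B‖ ≤ b` on the box's bonds with `L^{j+1}b` in [3] Prop. 4's window, and (1.35) holds on the level-`j` bonds of `B(c₋)` and at `c` for
`U′U₀ = U₁^{u}U₀`, `u` with values in `{|u|, |u⁻¹| ≤ 1}`, THEN `‖Q_{j+1}(U₀, B)(c)‖ < 2dLα₁`.  The `U1`-membership of the averages of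
`U′U₀ = (e^{B}U₀)^{u}` that the global lemma asks is DERIVED here for the clamped data ([3] Prop. 2 for the clamped `e^{B}U₀` via
`B7Eq123General.level_data` + the gauge covariance (11) `B7AvgGaugeCovariance.avgIter_gaugeAct`).
[cite: Balaban1985RegularSpaces, (1.42) p.83, (1.37) + (1.31) p.82, (1.35) p.82; Balaban1985Averaging, p.24, (11) p.19, (87) p.31] -/
theorem norm_Qj_lt_crossing_loc (L : ℕ) (hd : 1 ≤ d) (hL : 2 ≤ L) {G : Subgroup 𝔸ˣ} (hG : AvgClosed d L G)
    (j : ℕ) (U₀ : Site d → Fin d → 𝔸ˣ) (y : Site d) (κ : Fin d)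
    (hU₀ : ∀ x μ, U₀ x μ ∈ G)
    {α₀ : ℝ} (hα₀ : 0 < α₀) (hα3 : C0 d * α₀ ≤ 1 / 3) (hα4 : 4 * α₀ ≤ c2' d L)
    (h40 : ∀ (x : Site d) (μ ν : Fin d), μ ≠ ν → PlaqIn (loK L (j + 1) y) (bondHiK L (j + 1) y κ) (x, μ, ν) →
      ‖((hol U₀ x (plaqWord μ ν) : 𝔸ˣ) : 𝔸) - 1‖ < α₀ * (((L : ℝ) ^ (j + 1))⁻¹) ^ 2)
    (B : Site d → Fin d → 𝔸) (hBG : ∀ x μ, expCfg B x μ ∈ G) {b : ℝ} (hb : 0 ≤ b)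
    (hB : ∀ x μ, BondIn (loK L (j + 1) y) (bondHiK L (j + 1) y κ) x μ → ‖B x μ‖ ≤ b)
    (hsm : Real.exp (4 * (800 * ((d : ℝ) + 1) ^ 2 * ((d : ℝ) + 4)) * α₀)
      * (1 + 8 * (131072 * ((d : ℝ) + 1) ^ 2) * ((L : ℝ) ^ (j + 1) * b)) ≤ 2)
    (hc₃ : 2 * ((L : ℝ) ^ (j + 1) * b) ≤ c3 d L)
    (u : Site d → 𝔸ˣ) (hu : ∀ x, u x ∈ U1 𝔸) (U₁ : Site d → Fin d → 𝔸ˣ)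
    (hU₁ : AgreeOn (loK L (j + 1) y) (bondHiK L (j + 1) y κ) U₁ (expCfg B))
    (h40' : ∀ (x : Site d) (μ ν : Fin d), μ ≠ ν → PlaqIn (loK L (j + 1) y) (bondHiK L (j + 1) y κ) (x, μ, ν) →
      ‖((hol (U₁ * U₀) x (plaqWord μ ν) : 𝔸ˣ) : 𝔸) - 1‖ < α₀ * (((L : ℝ) ^ (j + 1))⁻¹) ^ 2)
    (h87 : ∀ x : Site d, (L : ℤ) • y ≤ x → x ≤ (L : ℤ) • y + blockTop L → uLev L u j x = (wrec L U₀ U₁ j x)⁻¹)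
    (hp : uLev L u (j + 1) (y + e κ) = (wrec L U₀ U₁ (j + 1) (y + e κ))⁻¹)
    {α₁ : ℝ} (hα : 0 < α₁) (hsmall : (d : ℝ) * L * α₁ ≤ 1 / 8)
    (h135 : ∀ (z : Site d) (μ : Fin d), (L : ℤ) • y ≤ z → z + e μ ≤ (L : ℤ) • y + blockTop L →
      ‖(avgIter L (mgauge U₀ u U₁ * U₀) j z μ : 𝔸) - (avgIter L U₀ j z μ : 𝔸)‖ ≤ α₁)
    (h135b : ‖(avgIter L (mgauge U₀ u U₁ * U₀) (j + 1) y κ : 𝔸) - (avgIter L U₀ (j + 1) y κ : 𝔸)‖ ≤ α₁) :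
    ‖logCovIter L U₀ B (j + 1) y κ‖ < 2 * d * L * α₁ := by
  have hL1 : 1 ≤ L := le_trans (by norm_num) hL
  have hα2 : 2 * α₀ ≤ c2' d L := by linarith
  set lo := loK L (j + 1) y with hlo
  set hi := bondHiK L (j + 1) y κ with hhi
  have hlohi : ∀ i, lo i ≤ hi i := loK_le_bondHiK' hL1 (j + 1) y κ
  have hU₀1 : ∀ x μ, U₀ x μ ∈ U1 𝔸 := fun x μ => hG.le_U1 (hU₀ x μ)
  -- the clamped background
  set U₀' := clampCfg lo hi U₀ with hU₀'_def
  have hU₀'G : ∀ x μ, U₀' x μ ∈ G := clampCfg_mem hU₀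
  have hpdOn : pdevOn lo hi U₀ < α₀ * (((L : ℝ) ^ (j + 1))⁻¹) ^ 2 := by
    refine pdevOn_lt_of_forall (by positivity) fun x μ ν hx hx' => ?_
    rcases eq_or_ne μ ν with rfl | hμν
    · rw [hol_plaqWord_self, Units.val_one, sub_self, norm_zero]; positivity
    · exact h40 x μ ν hμν ⟨hx, hx'⟩
  have hpdev : pdev U₀' < α₀ * (((L : ℝ) ^ (j + 1))⁻¹) ^ 2 := (pdev_clampCfg_le hlohi hU₀1).trans_lt hpdOn
  -- the clamped exponent
  set Bc : Site d → Fin d → 𝔸 := fun x μ => if lo μ ≤ x μ ∧ x μ < hi μ then B (clamp lo hi x) μ else 0 with hBc_def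
  have hexp : clampCfg lo hi (expCfg B) = expCfg Bc := clampCfg_expCfg' lo hi B
  have hBc : ∀ x μ, ‖Bc x μ‖ ≤ b := norm_clampB_le' hlohi hb hB
  have hBcG : ∀ x μ, expCfg Bc x μ ∈ G := fun x μ => by rw [← hexp]; exact clampCfg_mem hBG x μ
  -- agreements on the box
  have hagU : AgreeOn lo hi U₀' U₀ := clampCfg_agree U₀
  have hagEc : AgreeOn lo hi (expCfg Bc) (expCfg B) := by rw [← hexp]; exact clampCfg_agree (expCfg B)
  have hagE : AgreeOn lo hi U₁ (expCfg Bc) := fun x μ hx hxe => by rw [hU₁ x μ hx hxe, hagEc x μ hx hxe]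
  have hagB : AgreeOn lo hi B Bc := fun x μ hx hxe => by
    have hr : lo μ ≤ x μ ∧ x μ < hi μ := ⟨(hx μ).1, by have := (hxe μ).2; rw [add_e_apply, if_pos rfl] at this; omega⟩
    simp only [hBc_def, hr, and_self, if_true, clamp_of_inBox hx]
  -- the clamped product `e^{Bc}·π^*U₀ = π^*(U₁U₀)` is `G`-valued with small plaquettes: [3] Prop. 2 applies to it
  set V := expCfg Bc * U₀' with hV_def
  have hVG : ∀ x μ, V x μ ∈ G := fun x μ => by
    rw [hV_def, Pi.mul_apply]; exact G.mul_mem (hBcG x μ) (hU₀'G x μ)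
  have hprod : V = clampCfg lo hi (expCfg B * U₀) := by rw [hV_def, clampCfg_mul', hexp]
  have hPU : ∀ x μ, (expCfg B * U₀) x μ ∈ U1 𝔸 := fun x μ => by
    rw [Pi.mul_apply]; exact (U1 𝔸).mul_mem (hG.le_U1 (hBG x μ)) (hU₀1 x μ)
  have hagP : AgreeOn lo hi (expCfg B * U₀) (U₁ * U₀) := B7LocalityGeneral.agreeOn_mul (fun x μ hx hxe => (hU₁ x μ hx hxe).symm)
    (fun _ _ _ _ => rfl)
  have hpdP : pdevOn lo hi (expCfg B * U₀) < α₀ * (((L : ℝ) ^ (j + 1))⁻¹) ^ 2 := by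
    refine pdevOn_lt_of_forall (by positivity) fun x μ ν hx hx' => ?_
    rcases eq_or_ne μ ν with rfl | hμν
    · rw [hol_plaqWord_self, Units.val_one, sub_self, norm_zero]; positivity
    · rw [B8Ineq130.hol_plaqWord_congr hagP x μ ν hx hx']
      exact h40' x μ ν hμν ⟨hx, hx'⟩
  have hPV : pdev V < α₀ * (((L : ℝ) ^ (j + 1))⁻¹) ^ 2 := by
    rw [hprod]; exact (pdev_clampCfg_le hlohi hPU).trans_lt hpdP
  -- `U1`-membership of the averages of `(e^{Bc}U₀')^{u}` at the levels `≤ j + 1` (Prop. 2 + gauge covariance (11))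
  have hfield : mgauge U₀' u (expCfg Bc) * U₀' = gaugeAct u V := mgauge_mul U₀' u (expCfg Bc)
  have havU1 : ∀ j', j' ≤ j + 1 → ∀ x μ, avgIter L (mgauge U₀' u (expCfg Bc) * U₀') j' x μ ∈ U1 𝔸 := by
    intro j' hj' x μ
    rw [hfield, B7AvgGaugeCovariance.avgIter_gaugeAct L hL hG (j + 1) V hVG hu hα₀ hα3 hα2 hPV j' hj']
    have hX := (B7Eq123General.level_data L hL hG (j + 1) V hVG hα₀ hα3 hα4 hPV j' hj').1 x μ
    show uLev L u j' x * avgIter L V j' x μ * (uLev L u j' (x + e μ))⁻¹ ∈ U1 𝔸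
    exact (U1 𝔸).mul_mem ((U1 𝔸).mul_mem (B7AvgGaugeCovariance.uLev_mem hu L j' x) hX) ((U1 𝔸).inv_mem (B7AvgGaugeCovariance.uLev_mem hu L j' _))
  -- (87) for the clamped pair: on the block under `c₋` (level `j`) and at `c₊` (level `j + 1`)
  have h87' : ∀ x : Site d, InBox ((L : ℤ) • y) ((L : ℤ) • y + blockTop L) x → uLev L u j x = (wrec L U₀' (expCfg Bc) j x)⁻¹ := by
    intro x hx
    have hx1 : (L : ℤ) • y ≤ x := fun i => (hx i).1
    have hx2 : x ≤ (L : ℤ) • y + blockTop L := fun i => (hx i).2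
    have hsub : ∀ w, InBox (tlo L x j) (thi L x j) w → InBox lo hi w := fun w hw =>
      inBox_box_of_tower_fst L (j + 1) y κ (B8Thm4TruncationLocal.tower_sub_of_under_one (under_one_of_block' hx1 hx2) hw)
    rw [h87 x hx1 hx2, wrec_congr_tower hL1 (agreeOn_of_subbox hsub hagU).symm (agreeOn_of_subbox hsub hagE) j 0 (by omega) x
      (by rw [B8Ineq130.tlo_zero]) (by rw [B8Ineq130.thi_zero])]
  have hp' : uLev L u (j + 1) (y + e κ) = (wrec L U₀' (expCfg Bc) (j + 1) (y + e κ))⁻¹ := by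
    have hsub : ∀ w, InBox (tlo L (y + e κ) (j + 1)) (thi L (y + e κ) (j + 1)) w → InBox lo hi w := fun w hw =>
      inBox_box_of_tower_snd (j + 1) y κ hw
    rw [hp, wrec_congr_tower hL1 (agreeOn_of_subbox hsub hagU).symm (agreeOn_of_subbox hsub hagE) (j + 1) 0 (by omega) (y + e κ)
      (by rw [B8Ineq130.tlo_zero]) (by rw [B8Ineq130.thi_zero])]
  -- (1.35) for the clamped pair: on the level-`j` bonds of the block and at `c`
  have hagF : AgreeOn lo hi (mgauge U₀' u (expCfg Bc) * U₀') (mgauge U₀ u U₁ * U₀) := fun x μ hx hxe => by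
    show mgauge U₀' u (expCfg Bc) x μ * U₀' x μ = mgauge U₀ u U₁ x μ * U₀ x μ
    rw [mgauge_apply, mgauge_apply, hagU x μ hx hxe, (hagE x μ hx hxe).symm]
  have h135' : ∀ (z : Site d) (μ : Fin d), (L : ℤ) • y ≤ z → z + e μ ≤ (L : ℤ) • y + blockTop L →
      ‖(avgIter L (mgauge U₀' u (expCfg Bc) * U₀') j z μ : 𝔸) - (avgIter L U₀' j z μ : 𝔸)‖ ≤ α₁ := by
    intro z μ hz1 hz2
    have hsub : AgreeOn (loK L j z) (bondHiK L j z μ) (mgauge U₀' u (expCfg Bc) * U₀') (mgauge U₀ u U₁ * U₀) :=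
      agreeOn_of_subbox (fun w hw => inBox_box_of_blockBond hL1 j y κ hz1 hz2 hw) hagF
    have hsub₀ : AgreeOn (loK L j z) (bondHiK L j z μ) U₀' U₀ :=
      agreeOn_of_subbox (fun w hw => inBox_box_of_blockBond hL1 j y κ hz1 hz2 hw) hagU
    rw [avgIter_congr L hL1 j z μ hsub, avgIter_congr L hL1 j z μ hsub₀]
    exact h135 z μ hz1 hz2
  have h135b' : ‖(avgIter L (mgauge U₀' u (expCfg Bc) * U₀') (j + 1) y κ : 𝔸) - (avgIter L U₀' (j + 1) y κ : 𝔸)‖ ≤ α₁ := by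
    rw [avgIter_congr L hL1 (j + 1) y κ hagF, avgIter_congr L hL1 (j + 1) y κ hagU]; exact h135b
  -- the global lemma for the clamped data at `k := j + 1`, transported back
  have key := B8Eq137QjEqB.norm_Qj_lt_crossing_regular L hd hL hG (j + 1) U₀' hU₀'G hα₀ hα3 hα4 hpdev Bc hb hBc hsm hc₃ u le_rfl y κ
    h87' hp' (havU1 j (Nat.le_succ j)) (havU1 (j + 1) le_rfl y κ) hα hsmall h135' h135b'
  rwa [logCovIter_congr L hL1 (j + 1) y κ hagU hagB.symm] at key

/-- **THE (1.42) CLAUSE AT ONE MIRRORED CROSSING CONSTRAINT BOND FROM BOX DATA** (`c₋` a constraint site of level `j + 1`, the `L`-block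
`B(c₊)` made of constraint sites of level `j`): the tower-local form of `B8Eq137QjEqB.norm_Qj_lt_crossing_mirrored` in [3] Prop. 4's regime
(the identification (127) `hId` and the `U1`-memberships discharged for the clamped data by `B7Eq123General.dbavgCovIter_eq_expCfg_logCovIter` /
`level_data` and the gauge covariance (11)); hypotheses as in `norm_Qj_lt_crossing_loc` with the roles of `c₋`, `c₊` exchanged.
[cite: Balaban1985RegularSpaces, (1.42) p.83, (1.37) + (1.31) p.82, (1.35) p.82; Balaban1985Averaging, p.24, (11) p.19, (87) p.31, (127) p.37] -/
theorem norm_Qj_lt_crossing_mirrored_loc (L : ℕ) (hd : 1 ≤ d) (hL : 2 ≤ L) {G : Subgroup 𝔸ˣ} (hG : AvgClosed d L G)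
    (j : ℕ) (U₀ : Site d → Fin d → 𝔸ˣ) (y : Site d) (κ : Fin d)
    (hU₀ : ∀ x μ, U₀ x μ ∈ G)
    {α₀ : ℝ} (hα₀ : 0 < α₀) (hα3 : C0 d * α₀ ≤ 1 / 3) (hα4 : 4 * α₀ ≤ c2' d L)
    (h40 : ∀ (x : Site d) (μ ν : Fin d), μ ≠ ν → PlaqIn (loK L (j + 1) y) (bondHiK L (j + 1) y κ) (x, μ, ν) →
      ‖((hol U₀ x (plaqWord μ ν) : 𝔸ˣ) : 𝔸) - 1‖ < α₀ * (((L : ℝ) ^ (j + 1))⁻¹) ^ 2)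
    (B : Site d → Fin d → 𝔸) (hBG : ∀ x μ, expCfg B x μ ∈ G) {b : ℝ} (hb : 0 ≤ b)
    (hB : ∀ x μ, BondIn (loK L (j + 1) y) (bondHiK L (j + 1) y κ) x μ → ‖B x μ‖ ≤ b)
    (hsm : Real.exp (4 * (800 * ((d : ℝ) + 1) ^ 2 * ((d : ℝ) + 4)) * α₀)
      * (1 + 8 * (131072 * ((d : ℝ) + 1) ^ 2) * ((L : ℝ) ^ (j + 1) * b)) ≤ 2)
    (hc₃ : 2 * ((L : ℝ) ^ (j + 1) * b) ≤ c3 d L)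
    (u : Site d → 𝔸ˣ) (hu : ∀ x, u x ∈ U1 𝔸) (U₁ : Site d → Fin d → 𝔸ˣ)
    (hU₁ : AgreeOn (loK L (j + 1) y) (bondHiK L (j + 1) y κ) U₁ (expCfg B))
    (h40' : ∀ (x : Site d) (μ ν : Fin d), μ ≠ ν → PlaqIn (loK L (j + 1) y) (bondHiK L (j + 1) y κ) (x, μ, ν) →
      ‖((hol (U₁ * U₀) x (plaqWord μ ν) : 𝔸ˣ) : 𝔸) - 1‖ < α₀ * (((L : ℝ) ^ (j + 1))⁻¹) ^ 2)
    (hm : uLev L u (j + 1) y = (wrec L U₀ U₁ (j + 1) y)⁻¹)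
    (h87 : ∀ x : Site d, (L : ℤ) • (y + e κ) ≤ x → x ≤ (L : ℤ) • (y + e κ) + blockTop L → uLev L u j x = (wrec L U₀ U₁ j x)⁻¹)
    {α₁ : ℝ} (hα : 0 < α₁) (hsmall : (d : ℝ) * L * α₁ ≤ 1 / 8)
    (h135 : ∀ (z : Site d) (μ : Fin d), (L : ℤ) • (y + e κ) ≤ z → z + e μ ≤ (L : ℤ) • (y + e κ) + blockTop L →
      ‖(avgIter L (mgauge U₀ u U₁ * U₀) j z μ : 𝔸) - (avgIter L U₀ j z μ : 𝔸)‖ ≤ α₁)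
    (h135b : ‖(avgIter L (mgauge U₀ u U₁ * U₀) (j + 1) y κ : 𝔸) - (avgIter L U₀ (j + 1) y κ : 𝔸)‖ ≤ α₁) :
    ‖logCovIter L U₀ B (j + 1) y κ‖ < 2 * d * L * α₁ := by
  have hL1 : 1 ≤ L := le_trans (by norm_num) hL
  have hα2 : 2 * α₀ ≤ c2' d L := by linarith
  set lo := loK L (j + 1) y with hlo
  set hi := bondHiK L (j + 1) y κ with hhi
  have hlohi : ∀ i, lo i ≤ hi i := loK_le_bondHiK' hL1 (j + 1) y κ
  have hU₀1 : ∀ x μ, U₀ x μ ∈ U1 𝔸 := fun x μ => hG.le_U1 (hU₀ x μ)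
  set U₀' := clampCfg lo hi U₀ with hU₀'_def
  have hU₀'G : ∀ x μ, U₀' x μ ∈ G := clampCfg_mem hU₀
  have hpdOn : pdevOn lo hi U₀ < α₀ * (((L : ℝ) ^ (j + 1))⁻¹) ^ 2 := by
    refine pdevOn_lt_of_forall (by positivity) fun x μ ν hx hx' => ?_
    rcases eq_or_ne μ ν with rfl | hμν
    · rw [hol_plaqWord_self, Units.val_one, sub_self, norm_zero]; positivity
    · exact h40 x μ ν hμν ⟨hx, hx'⟩
  have hpdev : pdev U₀' < α₀ * (((L : ℝ) ^ (j + 1))⁻¹) ^ 2 := (pdev_clampCfg_le hlohi hU₀1).trans_lt hpdOn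
  set Bc : Site d → Fin d → 𝔸 := fun x μ => if lo μ ≤ x μ ∧ x μ < hi μ then B (clamp lo hi x) μ else 0 with hBc_def
  have hexp : clampCfg lo hi (expCfg B) = expCfg Bc := clampCfg_expCfg' lo hi B
  have hBc : ∀ x μ, ‖Bc x μ‖ ≤ b := norm_clampB_le' hlohi hb hB
  have hBcG : ∀ x μ, expCfg Bc x μ ∈ G := fun x μ => by rw [← hexp]; exact clampCfg_mem hBG x μ
  have hagU : AgreeOn lo hi U₀' U₀ := clampCfg_agree U₀
  have hagEc : AgreeOn lo hi (expCfg Bc) (expCfg B) := by rw [← hexp]; exact clampCfg_agree (expCfg B)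
  have hagE : AgreeOn lo hi U₁ (expCfg Bc) := fun x μ hx hxe => by rw [hU₁ x μ hx hxe, hagEc x μ hx hxe]
  have hagB : AgreeOn lo hi B Bc := fun x μ hx hxe => by
    have hr : lo μ ≤ x μ ∧ x μ < hi μ := ⟨(hx μ).1, by have := (hxe μ).2; rw [add_e_apply, if_pos rfl] at this; omega⟩
    simp only [hBc_def, hr, and_self, if_true, clamp_of_inBox hx]
  set V := expCfg Bc * U₀' with hV_def
  have hVG : ∀ x μ, V x μ ∈ G := fun x μ => by
    rw [hV_def, Pi.mul_apply]; exact G.mul_mem (hBcG x μ) (hU₀'G x μ)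
  have hprod : V = clampCfg lo hi (expCfg B * U₀) := by rw [hV_def, clampCfg_mul', hexp]
  have hPU : ∀ x μ, (expCfg B * U₀) x μ ∈ U1 𝔸 := fun x μ => by
    rw [Pi.mul_apply]; exact (U1 𝔸).mul_mem (hG.le_U1 (hBG x μ)) (hU₀1 x μ)
  have hagP : AgreeOn lo hi (expCfg B * U₀) (U₁ * U₀) := B7LocalityGeneral.agreeOn_mul (fun x μ hx hxe => (hU₁ x μ hx hxe).symm)
    (fun _ _ _ _ => rfl)
  have hpdP : pdevOn lo hi (expCfg B * U₀) < α₀ * (((L : ℝ) ^ (j + 1))⁻¹) ^ 2 := by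
    refine pdevOn_lt_of_forall (by positivity) fun x μ ν hx hx' => ?_
    rcases eq_or_ne μ ν with rfl | hμν
    · rw [hol_plaqWord_self, Units.val_one, sub_self, norm_zero]; positivity
    · rw [B8Ineq130.hol_plaqWord_congr hagP x μ ν hx hx']
      exact h40' x μ ν hμν ⟨hx, hx'⟩
  have hPV : pdev V < α₀ * (((L : ℝ) ^ (j + 1))⁻¹) ^ 2 := by
    rw [hprod]; exact (pdev_clampCfg_le hlohi hPU).trans_lt hpdP
  have hfield : mgauge U₀' u (expCfg Bc) * U₀' = gaugeAct u V := mgauge_mul U₀' u (expCfg Bc)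
  have havU1 : ∀ j', j' ≤ j + 1 → ∀ x μ, avgIter L (mgauge U₀' u (expCfg Bc) * U₀') j' x μ ∈ U1 𝔸 := by
    intro j' hj' x μ
    rw [hfield, B7AvgGaugeCovariance.avgIter_gaugeAct L hL hG (j + 1) V hVG hu hα₀ hα3 hα2 hPV j' hj']
    have hX := (B7Eq123General.level_data L hL hG (j + 1) V hVG hα₀ hα3 hα4 hPV j' hj').1 x μ
    show uLev L u j' x * avgIter L V j' x μ * (uLev L u j' (x + e μ))⁻¹ ∈ U1 𝔸
    exact (U1 𝔸).mul_mem ((U1 𝔸).mul_mem (B7AvgGaugeCovariance.uLev_mem hu L j' x) hX)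
      ((U1 𝔸).inv_mem (B7AvgGaugeCovariance.uLev_mem hu L j' _))
  have hV₀ : ∀ x μ, avgIter L U₀' j x μ ∈ U1 𝔸 :=
    (B7Eq123General.level_data L hL hG (j + 1) U₀' hU₀'G hα₀ hα3 hα4 hpdev j (Nat.le_succ j)).1
  have hW₀ : avgIter L U₀' (j + 1) y κ ∈ U1 𝔸 :=
    (B7Eq123General.level_data L hL hG (j + 1) U₀' hU₀'G hα₀ hα3 hα4 hpdev (j + 1) le_rfl).1 y κ
  have hId := B7Eq123General.dbavgCovIter_eq_expCfg_logCovIter L hL hG (j + 1) U₀' hU₀'G hα₀ hα3 hα4 hpdev Bc hb hBc hsm hc₃ j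
    (Nat.le_succ j)
  -- (87): at `c₋` (level `j + 1`) and on the block `B(c₊)` (level `j`)
  have hm' : uLev L u (j + 1) y = (wrec L U₀' (expCfg Bc) (j + 1) y)⁻¹ := by
    have hsub : ∀ w, InBox (tlo L y (j + 1)) (thi L y (j + 1)) w → InBox lo hi w := fun w hw =>
      inBox_box_of_tower_fst L (j + 1) y κ hw
    rw [hm, wrec_congr_tower hL1 (agreeOn_of_subbox hsub hagU).symm (agreeOn_of_subbox hsub hagE) (j + 1) 0 (by omega) y
      (by rw [B8Ineq130.tlo_zero]) (by rw [B8Ineq130.thi_zero])]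
  have h87' : ∀ x : Site d, InBox ((L : ℤ) • (y + e κ)) ((L : ℤ) • (y + e κ) + blockTop L) x →
      uLev L u j x = (wrec L U₀' (expCfg Bc) j x)⁻¹ := by
    intro x hx
    have hx1 : (L : ℤ) • (y + e κ) ≤ x := fun i => (hx i).1
    have hx2 : x ≤ (L : ℤ) • (y + e κ) + blockTop L := fun i => (hx i).2
    have hsub : ∀ w, InBox (tlo L x j) (thi L x j) w → InBox lo hi w := fun w hw =>
      inBox_box_of_tower_snd (j + 1) y κ (B8Thm4TruncationLocal.tower_sub_of_under_one (under_one_of_block' hx1 hx2) hw)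
    rw [h87 x hx1 hx2, wrec_congr_tower hL1 (agreeOn_of_subbox hsub hagU).symm (agreeOn_of_subbox hsub hagE) j 0 (by omega) x
      (by rw [B8Ineq130.tlo_zero]) (by rw [B8Ineq130.thi_zero])]
  -- (1.35): on the level-`j` bonds of `B(c₊)` and at `c`
  have hagF : AgreeOn lo hi (mgauge U₀' u (expCfg Bc) * U₀') (mgauge U₀ u U₁ * U₀) := fun x μ hx hxe => by
    show mgauge U₀' u (expCfg Bc) x μ * U₀' x μ = mgauge U₀ u U₁ x μ * U₀ x μ
    rw [mgauge_apply, mgauge_apply, hagU x μ hx hxe, (hagE x μ hx hxe).symm]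
  -- the locality box of a level-`j` bond of `B(c₊)` sits in the box of `c`
  have hblk : ∀ (z : Site d) (μ : Fin d), (L : ℤ) • (y + e κ) ≤ z → z + e μ ≤ (L : ℤ) • (y + e κ) + blockTop L →
      ∀ w, InBox (loK L j z) (bondHiK L j z μ) w → InBox lo hi w :=
    fun z μ hz1 hz2 w hw => inBox_box_of_blockBond_snd hL1 j y κ hz1 hz2 hw
  have h135' : ∀ (z : Site d) (μ : Fin d), (L : ℤ) • (y + e κ) ≤ z → z + e μ ≤ (L : ℤ) • (y + e κ) + blockTop L →
      ‖(avgIter L (mgauge U₀' u (expCfg Bc) * U₀') j z μ : 𝔸) - (avgIter L U₀' j z μ : 𝔸)‖ ≤ α₁ := by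
    intro z μ hz1 hz2
    rw [avgIter_congr L hL1 j z μ (agreeOn_of_subbox (hblk z μ hz1 hz2) hagF),
      avgIter_congr L hL1 j z μ (agreeOn_of_subbox (hblk z μ hz1 hz2) hagU)]
    exact h135 z μ hz1 hz2
  have h135b' : ‖(avgIter L (mgauge U₀' u (expCfg Bc) * U₀') (j + 1) y κ : 𝔸) - (avgIter L U₀' (j + 1) y κ : 𝔸)‖ ≤ α₁ := by
    rw [avgIter_congr L hL1 (j + 1) y κ hagF, avgIter_congr L hL1 (j + 1) y κ hagU]; exact h135b
  have key := B8Eq137QjEqB.norm_Qj_lt_crossing_mirrored L hd hL1 U₀' Bc u j hId y κ hm' h87' (havU1 j (Nat.le_succ j)) hV₀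
    (havU1 (j + 1) le_rfl y κ) hW₀ hα hsmall h135' h135b'
  rwa [logCovIter_congr L hL1 (j + 1) y κ hagU hagB.symm] at key

end Crossing

#print axioms norm_Qj_lt_crossing_loc
#print axioms norm_Qj_lt_crossing_mirrored_loc

/-! ## §6 (v1.1) The (1.42) clause at `k` levels for gauge-fixed fields on a GENERAL constraint-bond family (interior, crossing and
mirrored-crossing bonds of (1.31)): `H42` of `B8Prop3GaugeFixedKLevel` as a theorem, and Theorem 4's existence clause modulo Prop. 5 + b9 -/

section General

variable {𝔸 : Type*} [CStarAlgebra 𝔸] [Nontrivial 𝔸]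

open B8Thm2LogB (blockTop)

/-- **THE (1.42) CLAUSE AT `k` LEVELS FOR GAUGE-FIXED FIELDS — `H42` OF `B8Prop3GaugeFixedKLevel.hP3_gaugeFixed_of_b9` AS A THEOREM for a
constraint-bond family `Λb m j` each of whose bonds `c = ⟨y, y + e_κ⟩` is (`hclass`) EITHER interior (both end-points in `Λs m j`) OR a
crossing bond of (1.31) (`j = j′ + 1`, the `L`-block `B(c₋)` made of sites of `Λs m j′`, `c₊ ∈ Λs m j`) OR a mirrored crossing bond
(`c₋ ∈ Λs m j`, `B(c₊)` made of sites of `Λs m j′`).**  Caller's standing hypotheses: (1.33) `h33`, (1.34) `h34` (plaquette part, for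
`U′U₀`) and `hAx` (axial part, truncated structures), (1.35) `h135` ON EVERY LEVEL-`j` BOND WHOSE LOCALITY BOX LIES IN `Ω_j` (`avgIter`
currency), `Ω` antitone, boxes of constraint bonds inside `Ω_j` (`hbox`), the windows at `α₂`, `d ≥ 2`, `L ≥ 2`, `η > 0`, `U₀`
unitary-valued (`U′`'s regularity enters only through `h34`/`hAx`).  [cite: Balaban1985RegularSpaces, (1.42) p.83, (1.37) + (1.30)–(1.31) p.82, (1.35) p.82, (1.29) p.81, (1.19) p.79, Thm 4 p.88] -/
theorem H42_of_inAx (hd2 : 2 ≤ d) {η : ℝ} (hη : 0 < η) {L : ℕ} (hL : 2 ≤ L) (k : ℕ)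
    {U₀ U' : Site d → Fin d → 𝔸ˣ} (hU₀ : ∀ x κ, U₀ x κ ∈ unitaryUnits 𝔸)
    {α₀ α₁ α₂ : ℝ} (hα₀ : 0 < α₀) (hα₁ : 0 < α₁) (hα₂ : 0 ≤ α₂)
    (hα3 : C0 d * α₀ ≤ 1 / 3) (hα4 : 4 * α₀ ≤ c2' d L) (h16 : 16 * α₂ ≤ 1)
    (hsmall : Real.exp (4 * (800 * ((d : ℝ) + 1) ^ 2 * ((d : ℝ) + 4)) * α₀) * (1 + 8 * (131072 * ((d : ℝ) + 1) ^ 2) * α₂) ≤ 2)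
    (hc₃ : 2 * α₂ ≤ c3 d L) (hsmall₁ : (d : ℝ) * L * α₁ ≤ 1 / 8)
    (Ω : ℕ → Set (Site d)) (hΩ : ∀ j, Ω (j + 1) ⊆ Ω j) (Λs : ℕ → ℕ → Set (Site d)) (Λb : ℕ → ℕ → Set (Site d × Fin d))
    (hbox : ∀ m, m ≤ k → ∀ j, j ≤ m → ∀ c ∈ Λb m j, ∀ x, InBox (loK L j c.1) (bondHiK L j c.1 c.2) x → x ∈ Ω j)
    (hclass : ∀ m, m ≤ k → ∀ j, j ≤ m → ∀ c ∈ Λb m j,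
      (c.1 ∈ Λs m j ∧ c.1 + e c.2 ∈ Λs m j) ∨
      (∃ j', j = j' + 1 ∧ (∀ x, (L : ℤ) • c.1 ≤ x → x ≤ (L : ℤ) • c.1 + blockTop L → x ∈ Λs m j') ∧ c.1 + e c.2 ∈ Λs m j) ∨
      (∃ j', j = j' + 1 ∧ c.1 ∈ Λs m j ∧ (∀ x, (L : ℤ) • (c.1 + e c.2) ≤ x → x ≤ (L : ℤ) • (c.1 + e c.2) + blockTop L → x ∈ Λs m j')))
    (h33 : InAk L k η α₀ Ω U₀) (h34 : InAk L k η α₀ Ω (mulCfg U' U₀)) (hAx : ∀ m, m ≤ k → InAx L m (Λs m) U₀ (mulCfg U' U₀))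
    (h135 : ∀ j, j ≤ k → ∀ (z : Site d) (μ : Fin d), (∀ x, InBox (loK L j z) (bondHiK L j z μ) x → x ∈ Ω j) →
      ‖(avgIter L (mulCfg U' U₀) j z μ : 𝔸) - (avgIter L U₀ j z μ : 𝔸)‖ ≤ α₁)
    (Lan : ℕ → (Site d → Fin d → 𝔸ˣ) → Prop) :
    ∀ m, 1 ≤ m → m ≤ k → ∀ (u : Site d → 𝔸ˣ) (W : Site d → Fin d → 𝔸ˣ) (A' : Site d → Fin d → 𝔸),
      (∀ x, u x ∈ unitaryUnits 𝔸) → mgauge U₀ u W = U' → Restr129 L m (Λs m) U₀ u → Lan m W →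
      (∀ y τ, IsSelfAdjoint (A' y τ)) →
      (∀ j, j ≤ m → ∀ y τ, SideTouches (Ω j) y τ →
        W y τ = cfgExp η A' y τ ∧ ‖A' y τ‖ ≤ α₂ * ((L : ℝ) ^ j * η)⁻¹) →
      (∀ y τ, (∀ j, j ≤ m → ¬ SideTouches (Ω j) y τ) → A' y τ = 0) →
      ∀ j, j ≤ m → ∀ c ∈ Λb m j, ‖logCovIter L U₀ (iEta η A') j c.1 c.2‖ < 2 * d * L * α₁ := by
  intro m hm1 hmk u W A' hu hW h129 hLan hsa hWA hA0 j hj c hc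
  have hL1 : 1 ≤ L := le_trans (by norm_num) hL
  have hd1 : 1 ≤ d := le_trans (by norm_num) hd2
  have hLr : (1 : ℝ) ≤ L := by exact_mod_cast hL1
  have hG : AvgClosed d L (unitaryUnits 𝔸) := avgClosed_unitaryUnits d L
  have hu1 : ∀ x, u x ∈ U1 𝔸 := fun x => unitaryUnits_le_U1 (hu x)
  -- the field `WU₀` is `U′U₀`; its class `𝔄` by gauge invariance
  have hWU : mgauge U₀ u W * U₀ = mulCfg U' U₀ := by rw [hW]; rfl
  have h34W : InAk L m η α₀ Ω (mulCfg W U₀) := by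
    have h1 : InAk L m η α₀ Ω (mulCfg U' U₀) := fun j hj => h34 j (hj.trans hmk)
    have hui : ∀ x, u⁻¹ x ∈ U1 𝔸 := fun x => unitaryUnits_le_U1 ((unitaryUnits 𝔸).inv_mem (hu x))
    rw [B8Prop3GaugeFixedKLevel.mulCfg_eq_gaugeAct_of_mgauge_eq hW]
    exact (B8Ineq132.inAk_gaugeAct_iff L m η α₀ Ω hui _).2 h1
  -- (87) at all constraint sites, from (1.19)/(1.29)
  have h87 := eq87_of_inAx_restr129 L hL1 m (Λs m) U₀ W u (by rw [hWU]; exact hAx m hmk) h129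
  -- `e^{iηA′}` is unitary-valued
  have hBG : ∀ x μ, expCfg (iEta η A') x μ ∈ unitaryUnits 𝔸 := fun x μ => B8Eq155JBound.expCfg_iEta_mem_unitaryUnits η hsa x μ
  -- box data common to all cases, for the bond `c` at its level `j`
  have hboxbond : ∀ x μ, BondIn (loK L j c.1) (bondHiK L j c.1 c.2) x μ →
      W x μ = cfgExp η A' x μ ∧ ‖iEta η A' x μ‖ ≤ α₂ * ((L : ℝ) ^ j)⁻¹ := by
    intro x μ hb
    obtain ⟨ν, hν⟩ := exists_ne_dir' hd2 μ
    have hs : SideTouches (Ω j) x μ := sideTouches_of_bondTouches hν (Or.inl (hbox m hmk j hj c hc x hb.1))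
    obtain ⟨hWx, hAx'⟩ := hWA j hj x μ hs
    refine ⟨hWx, ?_⟩
    show ‖((I : ℂ) * η) • A' x μ‖ ≤ α₂ * ((L : ℝ) ^ j)⁻¹
    rw [norm_smul, norm_mul, Complex.norm_I, one_mul, Complex.norm_real, Real.norm_eq_abs, abs_of_pos hη]
    calc η * ‖A' x μ‖ ≤ η * (α₂ * ((L : ℝ) ^ j * η)⁻¹) := mul_le_mul_of_nonneg_left hAx' hη.le
      _ = α₂ * ((L : ℝ) ^ j)⁻¹ := by field_simp
  have hag : AgreeOn (loK L j c.1) (bondHiK L j c.1 c.2) W (expCfg (iEta η A')) := fun x μ hx hxe => by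
    rw [(hboxbond x μ ⟨hx, hxe⟩).1, expCfg_iEta_apply]
  have h40 : ∀ (x : Site d) (μ ν : Fin d), μ ≠ ν → PlaqIn (loK L j c.1) (bondHiK L j c.1 c.2) (x, μ, ν) →
      ‖((hol U₀ x (plaqWord μ ν) : 𝔸ˣ) : 𝔸) - 1‖ < α₀ * (((L : ℝ) ^ j)⁻¹) ^ 2 :=
    fun x μ ν hμν hp => (h33 j (hj.trans hmk)).1 x μ ν hμν (Or.inl (hbox m hmk j hj c hc x hp.1))
  have h40' : ∀ (x : Site d) (μ ν : Fin d), μ ≠ ν → PlaqIn (loK L j c.1) (bondHiK L j c.1 c.2) (x, μ, ν) →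
      ‖((hol (W * U₀) x (plaqWord μ ν) : 𝔸ˣ) : 𝔸) - 1‖ < α₀ * (((L : ℝ) ^ j)⁻¹) ^ 2 :=
    fun x μ ν hμν hp => (h34W j hj).1 x μ ν hμν (Or.inl (hbox m hmk j hj c hc x hp.1))
  -- (1.35) at `c` and on sub-boxes
  have h135c : ‖(avgIter L (mgauge U₀ u W * U₀) j c.1 c.2 : 𝔸) - (avgIter L U₀ j c.1 c.2 : 𝔸)‖ ≤ α₁ := by
    rw [hWU]; exact h135 j (hj.trans hmk) c.1 c.2 (hbox m hmk j hj c hc)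
  rcases hclass m hmk j hj c hc with ⟨hy, hyκ⟩ | ⟨j', rfl, hblk, hyκ⟩ | ⟨j', rfl, hy, hblk⟩
  · -- INTERIOR bond
    rcases j with _ | j
    · -- level 0
      have hb0 : BondIn (loK L 0 c.1) (bondHiK L 0 c.1 c.2) c.1 c.2 := by
        refine ⟨fun i => ?_, fun i => ?_⟩
        · simp only [loK, bondHiK, pow_zero, one_mul]; split_ifs <;> omega
        · simp only [loK, bondHiK, pow_zero, one_mul, add_e_apply]; split_ifs <;> omega
      obtain ⟨hWc, hAc⟩ := hboxbond c.1 c.2 hb0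
      have hlog2 : ‖iEta η A' c.1 c.2‖ < Real.log 2 := by
        have := Real.log_two_gt_d9
        rw [pow_zero, inv_one, mul_one] at hAc
        linarith
      have hm0 : uLev L u 0 c.1 = (wrec L U₀ (expCfg (iEta η A')) 0 c.1)⁻¹ := by
        rw [h87 0 (Nat.zero_le _) c.1 hy, wrec_zero, wrec_zero]
      have hp0 : uLev L u 0 (c.1 + e c.2) = (wrec L U₀ (expCfg (iEta η A')) 0 (c.1 + e c.2))⁻¹ := by
        rw [h87 0 (Nat.zero_le _) (c.1 + e c.2) hyκ, wrec_zero, wrec_zero]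
      have h₀ : avgIter L U₀ 0 c.1 c.2 ∈ U1 𝔸 := by rw [avgIter_zero]; exact unitaryUnits_le_U1 (hU₀ _ _)
      have h135' : ‖(avgIter L (mgauge U₀ u (expCfg (iEta η A')) * U₀) 0 c.1 c.2 : 𝔸) - (avgIter L U₀ 0 c.1 c.2 : 𝔸)‖ ≤ α₁ := by
        have hpt : (mgauge U₀ u (expCfg (iEta η A')) * U₀) c.1 c.2 = (mgauge U₀ u W * U₀) c.1 c.2 := by
          show mgauge U₀ u (expCfg (iEta η A')) c.1 c.2 * U₀ c.1 c.2 = mgauge U₀ u W c.1 c.2 * U₀ c.1 c.2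
          rw [mgauge_apply, mgauge_apply, expCfg_iEta_apply, ← hWc]
        have h := h135c
        rw [avgIter_zero, avgIter_zero] at h ⊢
        rw [hpt]
        exact h
      exact norm_Qj_lt_interior_zero L hd1 hL1 U₀ (iEta η A') u c.1 c.2 hlog2 hm0 hp0 h₀ hα₁ hsmall₁ h135'
    · -- level `j + 1`
      have hLb : (L : ℝ) ^ (j + 1) * (α₂ * ((L : ℝ) ^ (j + 1))⁻¹) = α₂ := by field_simp
      exact norm_Qj_lt_interior_loc L hd1 hL hG j U₀ c.1 c.2 hU₀ hα₀ hα3 hα4 h40 (iEta η A') (by positivity)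
        (fun x μ hbd => (hboxbond x μ hbd).2) (by rw [hLb]; exact hsmall) (by rw [hLb]; exact hc₃) u W hag
        (h87 (j + 1) hj c.1 hy) (h87 (j + 1) hj (c.1 + e c.2) hyκ) hα₁ hsmall₁ h135c
  · -- CROSSING bond at level `j' + 1`: the block `B(c₋)` consists of level-`j'` constraint sites
    have hLb : (L : ℝ) ^ (j' + 1) * (α₂ * ((L : ℝ) ^ (j' + 1))⁻¹) = α₂ := by field_simp
    refine norm_Qj_lt_crossing_loc L hd1 hL hG j' U₀ c.1 c.2 hU₀ hα₀ hα3 hα4 h40 (iEta η A') hBG (by positivity)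
      (fun x μ hbd => (hboxbond x μ hbd).2) (by rw [hLb]; exact hsmall) (by rw [hLb]; exact hc₃) u hu1 W hag h40'
      (fun x hx1 hx2 => h87 j' (by omega) x (hblk x hx1 hx2)) (h87 (j' + 1) hj (c.1 + e c.2) hyκ) hα₁ hsmall₁
      (fun z μ hz1 hz2 => ?_) h135c
    rw [hWU]
    refine h135 j' (by omega) z μ fun x hx => hΩ j' (hbox m hmk (j' + 1) hj c hc x ?_)
    exact inBox_box_of_blockBond hL1 j' c.1 c.2 hz1 hz2 hx
  · -- MIRRORED crossing bond at level `j' + 1`: the block `B(c₊)` consists of level-`j'` constraint sites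
    have hLb : (L : ℝ) ^ (j' + 1) * (α₂ * ((L : ℝ) ^ (j' + 1))⁻¹) = α₂ := by field_simp
    refine norm_Qj_lt_crossing_mirrored_loc L hd1 hL hG j' U₀ c.1 c.2 hU₀ hα₀ hα3 hα4 h40 (iEta η A') hBG (by positivity)
      (fun x μ hbd => (hboxbond x μ hbd).2) (by rw [hLb]; exact hsmall) (by rw [hLb]; exact hc₃) u hu1 W hag h40'
      (h87 (j' + 1) hj c.1 hy) (fun x hx1 hx2 => h87 j' (by omega) x (hblk x hx1 hx2)) hα₁ hsmall₁
      (fun z μ hz1 hz2 => ?_) h135c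
    rw [hWU]
    refine h135 j' (by omega) z μ fun x hx => hΩ j' (hbox m hmk (j' + 1) hj c hc x ?_)
    exact inBox_box_of_blockBond_snd hL1 j' c.1 c.2 hz1 hz2 hx

end General

#print axioms H42_of_inAx

end Literature.MathematicalPhysics.QuantumFieldTheory.Balaban1983to89.B8Eq142KLevelLocal

end
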